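import Literature.NumberTheory.LFunctions.UnconditionalPairCorrelationProofs
import HarnessLib

/-!
RH-FREE — «nothing here bears on the truth of RH».

# The unconditional Montgomery theorem over the ORIGINAL window `0 < γ, γ′ ≤ T`
# (Baluyot–Goldston–Suriajaya–Turnage-Butterbaugh, Acta Arith. 214 (2024), Theorem 1 with the
# error terms of the authors' 2025 correction; Lemma 4 and the proof of Theorem 1, §2)

Topic `Literature/NumberTheory/LFunctions` (namespace `Literature.NumberTheory.LFunctions`, objects in
`BGSTB2024`). PROOF LAYER: theorems only — no definitions, no named facts. Companion of the four files
`UnconditionalPairCorrelation{Kernel,ExplicitFormula,ZeroSide,Proofs}.lean`, which discharge the DYADIC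
statement `baluyotEtAl2025_montgomeryTheorem` (window `T < γ ≤ 2T` of arXiv:2501.14545 §2). Here the same
argument is run for the window of the 2024 paper itself, `0 < γ ≤ T` (`BGSTB2024.zerosUpTo`,
`BGSTB2024.pairSum` = `F(x,T)` of (1.2)), giving the CORRECTED form of Theorem 1:

* `BGSTB2024.upTo_zeroSide` — Lemma 4 for `0 < γ ≤ T`: for `T ≥ 4`, `x ≥ 1`, `θ ≤ 1` with `Re ρ ≤ θ` for every
  zero with `|γ| ≤ T²`: `|∫_0^T ‖S_u(x,t)‖² dt − (π/2) Re F(x,T)| ≤ C (x^{2θ−1} log³(T+2) + x log²(T+2)/T)`.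
* `BGSTB2024.rside_upTo` — the `R`-side on `[0,T]`:
  `|∫_0^T |2x^{1/2−it}S_u|² dt − (Tx log x + (T/x) log²T)| ≤ C (T log^{3/2}T/x + xT√log T)` (`1 ≤ x ≤ T`, `T ≥ 4`).
* `BGSTB2024.pairSum_montgomeryTheorem` — **(MT) for the original window**: there are `C, T₀` with
  `‖F(x,T) − ((T/(2πx²)) log²T + (T/2π) log x)‖ ≤ C ((T/(2πx²)) log²T/√log T + T√log T)` for `T ≥ T₀`,
  `1 ≤ x ≤ T`; and its normalised form `BGSTB2024.formFactor_montgomeryTheorem`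
  (`F(α) = T^{−2α} log T + α + O(T^{−2α}√log T + 1/√log T)` uniformly on `0 ≤ α ≤ 1`), i.e. Theorem 1 of the
  2024 paper with the precision that survives the authors' erratum (see the docstring of the
  `@[deprecated]` fact `baluyotEtAl2024_theorem1`, which keeps the RETRACTED precision and is NOT proved).

Status note (no endorsement): Theorem 1 of a refereed paper (Acta Arith. 2024) in the corrected form printed
in the unrefereed sequel arXiv:2501.14545 §2 ("all the applications of Theorem 1 in [BGST-PC], such as
Lemma 5 and Lemma 7, remain correct"); the dyadic statement is the tree theorem
`baluyotEtAl2025_montgomeryTheorem_holds`. This file is the input of the discharge of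
`baluyotEtAl2024_lemma5` (`UnconditionalPairCorrelationLemma5Proofs.lean`). Nothing here bears on the truth of RH.

Route = the printed proof of BGST 2024 §2 (p. 5 of the held text `paper:arxiv-2306.04799`), node by node as in
the dyadic files: `L(x,T) = ∫_0^T |l|² = R(x,T) = ∫_0^T |r|²`; zero side `L = 4x∫_0^T‖S_u‖² = 2πx F(x,T) +
O(x·x^{2θ−1} log³T + x²log²T/T)` (Lemma 3 `integral_norm_zeroKernelSum_zerosUpTo_sq` + Lemma 4, Montgomery's
argument with the factor `x^{δ+δ′} ≤ x^{2Θ−1}`); `R`-side by Lemma 1 (`baluyotEtAl2024_lemma1`), (P3♯)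
(`Montgomery.exists_meanSquare_dirichletSum_sharp`), `∫_0^T log²(t+2) = T log²T + O(T log T)`
(`Montgomery.abs_integral_log_add_two_sq_sub_le`) and the cross term
(`BGSTB2024.exists_norm_integral_log_mul_dirichletSum_le`); the Vinogradov–Korobov exponent
`BGSTB2024.exists_vkTheta`. The (0,T] window is the one of `MontgomeryZeroSideProofs.lean` (Montgomery 1973
§3 on the line): its unit-window sums (Za)–(Zd) and sup bounds (KB1), (KB3), (KB4) are used directly.

## References

* [BaluyotEtAl2024] Acta Arith. 214 (2024) 357–376 = arXiv:2306.04799: §2, Lemmas 1, 3, 4 and the proof of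
  Theorem 1 (held text `paper:arxiv-2306.04799`, p0004–p0005).
* [BaluyotEtAl2025] arXiv:2501.14545, §2 "Montgomery Theorem (MT)" (the corrected error terms) and §3.
* [GoldstonMontgomery1987] §3, Lemmas 6–8 ((P3♯)); [Goldston2005] §4; [Montgomery1973] §3.
-/

noncomputable section

open Complex Filter Set MeasureTheory intervalIntegral Asymptotics
open scoped Real Topology ComplexConjugate

namespace Literature.NumberTheory.LFunctions

namespace BGSTB2024

open Montgomery

/-! ## §1. Dictionary for the window `0 < γ ≤ T` -/

/-- The multiplicity weight as a complex number is the order. [folklore] -/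
private theorem mult_cast_eq_order' {ρ : ℂ} (hρ : ρ ∈ ZetaZeros.riemannZetaNontrivialZeros) :
    (mult ρ : ℂ) = (riemannZetaZeroOrder ρ : ℂ) := by
  have h := mult_eq_order hρ
  exact_mod_cast h

/-- **Box dictionary**: `Σ_{ρ: 0<γ≤T} m(ρ) g(γ) = Σ_{n<N(T)} g(γ_n)` (ordinates with multiplicity).
[cite: BaluyotEtAl2024, §1 («zeros are counted with multiplicity»)] -/
theorem sum_zerosUpTo_mult_mul_eq (g : ℝ → ℝ) (T : ℝ) :
    ∑ ρ ∈ zerosUpTo T, (mult ρ : ℝ) * g ρ.im =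
      ∑ n ∈ Finset.range (zetaZeroCount T), g (zetaOrdinate n) := by
  have h := OrdinateDictionary.sum_zetaZeroBox_mul_eq_sum_range (fun u ↦ ((g u : ℝ) : ℂ)) T
  have h' : ((∑ ρ ∈ zerosUpTo T, (mult ρ : ℝ) * g ρ.im : ℝ) : ℂ) =
      ((∑ n ∈ Finset.range (zetaZeroCount T), g (zetaOrdinate n) : ℝ) : ℂ) := by
    push_cast
    rw [← h, zerosUpTo]
    refine Finset.sum_congr rfl fun ρ hρ ↦ ?_
    have hρ' : ρ ∈ zerosUpTo T := by rw [zerosUpTo]; exact hρ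
    rw [mult_cast_eq_order' (mem_nontrivialZeros_of_mem_zerosUpTo hρ')]
  exact_mod_cast h'

/-- The box finset inside the subtype of non-trivial zeros, `{ρ : |Im ρ| ≤ T, 0 < Im ρ}`, maps onto
`zerosUpTo T`. [cite: BaluyotEtAl2024, §1 (1.2)] -/
theorem upToFinset_map (T : ℝ) :
    ((weilZeroFinset T).filter fun ρ : ZetaZeros.riemannZetaNontrivialZeros ↦ 0 < (ρ : ℂ).im).map
      (Function.Embedding.subtype _) =
      zerosUpTo T := by
  ext z
  simp only [Finset.mem_map, Function.Embedding.subtype_apply, Finset.mem_filter, mem_weilZeroFinset,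
    mem_zerosUpTo]
  constructor
  · rintro ⟨ρ, ⟨h1, h2⟩, rfl⟩
    exact ⟨ZetaZeros.riemannZetaNontrivialZeros.zeta_eq_zero ρ.2,
      (ZetaZeros.riemannZetaNontrivialZeros.re_pos ρ.2).le,
      (ZetaZeros.riemannZetaNontrivialZeros.re_lt_one ρ.2).le, h2, (le_abs_self _).trans h1⟩
  · rintro ⟨hζ, -, -, him, hT⟩
    refine ⟨⟨z, ZetaZeros.riemannZetaNontrivialZeros.mem_of_im_ne_zero hζ him.ne'⟩, ⟨?_, him⟩, rfl⟩
    simp only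
    rw [abs_of_pos him]
    exact hT

/-- Sums over the box finset are sums over `zerosUpTo T`. [cite: BaluyotEtAl2024, §1 (1.2)] -/
theorem sum_upToFinset_eq {M : Type*} [AddCommMonoid M] (f : ℂ → M) (T : ℝ) :
    ∑ ρ ∈ (weilZeroFinset T).filter (fun ρ : ZetaZeros.riemannZetaNontrivialZeros ↦ 0 < (ρ : ℂ).im),
      f ρ = ∑ z ∈ zerosUpTo T, f z := by
  rw [← upToFinset_map T, Finset.sum_map]
  rfl

/-- Comparison of Cauchy kernels: `m(ρ) g_t(Im ρ) ≤ 2(1+t²) m(ρ)/(1+γ²)`, hence summable over the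
zeros. [folklore] -/
private theorem summable_mult_mul_kernelR' (t : ℝ) :
    Summable fun ρ : ZetaZeros.riemannZetaNontrivialZeros ↦
      (mult (ρ : ℂ) : ℝ) * (1 / (1 + (t - (ρ : ℂ).im) ^ 2)) := by
  have hS : Summable fun ρ : ZetaZeros.riemannZetaNontrivialZeros ↦
      (riemannZetaZeroOrder (ρ : ℂ) : ℝ) / (1 + (ρ : ℂ).im ^ 2) :=
    ZetaZeroSum.summable_zeroOrder_div_one_add_sq
  refine Summable.of_nonneg_of_le (fun ρ ↦ by positivity) (fun ρ ↦ ?_) (hS.mul_left (2 * (1 + t ^ 2)))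
  have h := OrdinateDictionary.one_div_one_add_sq_sub_le t (ρ : ℂ).im
  have hm : (0 : ℝ) ≤ mult (ρ : ℂ) := Nat.cast_nonneg _
  rw [mult_eq_order ρ.2] at hm ⊢
  calc (riemannZetaZeroOrder (ρ : ℂ) : ℝ) * (1 / (1 + (t - (ρ : ℂ).im) ^ 2))
      ≤ (riemannZetaZeroOrder (ρ : ℂ) : ℝ) * (2 * (1 + t ^ 2) / (1 + (ρ : ℂ).im ^ 2)) :=
        mul_le_mul_of_nonneg_left h hm
    _ = 2 * (1 + t ^ 2) * ((riemannZetaZeroOrder (ρ : ℂ) : ℝ) / (1 + (ρ : ℂ).im ^ 2)) := by ring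

/-- `A_Z + Far_Z = Σ_n (1/(1+(t−γ_n)²) + 1/(1+(t+γ_n)²))` (all ordinates). [folklore] -/
private theorem truncDensity_add_farDensity' (Z t : ℝ) :
    truncDensity Z t + farDensity Z t =
      ∑' n : ℕ, (1 / (1 + (t - zetaOrdinate n) ^ 2) + 1 / (1 + (t + zetaOrdinate n) ^ 2)) :=
  ((summable_firstWeight t).add (summable_secondWeight t)).sum_add_tsum_nat_add (zetaZeroCount Z)

/-! ## §2. Pointwise majorants for the window `0 < γ ≤ T` -/

/-- **The box sum is majorised by the box density**: if every zero with `0 < γ ≤ T` has `Re ρ ≤ θ`,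
then `‖S₁(x,t)‖ ≤ 4 x^{θ−1/2} Σ_{n<N(T)} 1/(1+(t−γ_n)²)` (`x ≥ 1`), `S₁ = S_{(0,T]}`.
[cite: BaluyotEtAl2024, §2 (trivialestimate), (factor)] -/
theorem norm_zeroKernelSum_zerosUpTo_le {x : ℝ} (hx : 1 ≤ x) {T θ : ℝ}
    (hθ : ∀ ρ ∈ zerosUpTo T, ρ.re ≤ θ) (t : ℝ) :
    ‖zeroKernelSum (zerosUpTo T) x t‖ ≤
      4 * x ^ (θ - 1 / 2) * ∑ n ∈ Finset.range (zetaZeroCount T), 1 / (1 + (t - zetaOrdinate n) ^ 2) := by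
  have e := sum_zerosUpTo_mult_mul_eq (fun u ↦ 1 / (1 + (t - u) ^ 2)) T
  unfold zeroKernelSum
  rw [← e, Finset.mul_sum]
  refine (norm_sum_le _ _).trans (Finset.sum_le_sum fun ρ hρ ↦ ?_)
  exact norm_zeroKernelTerm_le_factor hx t (mem_nontrivialZeros_of_mem_zerosUpTo hρ) (hθ ρ hρ)

/-- **The tail of the zero side is majorised by the near and far densities** (window `0 < γ ≤ T`):
for `x ≥ 1`, `0 ≤ T ≤ Z`, and `Re ρ ≤ θ` for every non-trivial zero with `|Im ρ| ≤ Z`,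
`‖S_u(x,t) − S₁(x,t)‖ ≤ 4x^{1/2} (x^{θ−1} (A_Z(t) − D₀(t)) + Far_Z(t))`,
`D₀(t) = Σ_{n<N(T)} 1/(1+(t−γ_n)²)`.
[cite: BaluyotEtAl2024, Lemma 4 (proof: (trivialestimate), (trivialestimate2), (factor))] -/
theorem norm_zeroKernelSeries_sub_zerosUpTo_le {x : ℝ} (hx : 1 ≤ x) {T Z θ : ℝ}
    (hTZ : T ≤ Z)
    (hθ : ∀ ρ ∈ ZetaZeros.riemannZetaNontrivialZeros, |ρ.im| ≤ Z → ρ.re ≤ θ) (t : ℝ) :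
    ‖zeroKernelSeries x t - zeroKernelSum (zerosUpTo T) x t‖ ≤
      4 * x ^ (1 / 2 : ℝ) * (x ^ (θ - 1) *
        (truncDensity Z t - ∑ n ∈ Finset.range (zetaZeroCount T), 1 / (1 + (t - zetaOrdinate n) ^ 2)) +
          farDensity Z t) := by
  classical
  have hx0 : 0 < x := one_pos.trans_le hx
  set F : Finset ZetaZeros.riemannZetaNontrivialZeros :=
    (weilZeroFinset T).filter (fun ρ : ZetaZeros.riemannZetaNontrivialZeros ↦ 0 < (ρ : ℂ).im) with hF
  set FZ := weilZeroFinset Z with hFZ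
  have hFsub : F ⊆ FZ := by
    intro ρ hρ
    rw [hF, Finset.mem_filter, mem_weilZeroFinset] at hρ
    rw [hFZ, mem_weilZeroFinset]
    exact hρ.1.trans hTZ
  set μ : ℝ := x ^ (θ - 1) with hμ
  have hμ0 : 0 ≤ μ := by positivity
  -- the real kernel density with multiplicity and its majorant
  set g : ZetaZeros.riemannZetaNontrivialZeros → ℝ :=
    fun ρ ↦ (mult (ρ : ℂ) : ℝ) * (1 / (1 + (t - (ρ : ℂ).im) ^ 2)) with hg
  set c : ZetaZeros.riemannZetaNontrivialZeros → ℝ := fun ρ ↦ if |(ρ : ℂ).im| ≤ Z then μ else 1 with hc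
  set M : ZetaZeros.riemannZetaNontrivialZeros → ℝ := fun ρ ↦ 4 * x ^ (1 / 2 : ℝ) * (c ρ * g ρ) with hM
  have hg0 : ∀ ρ, 0 ≤ g ρ := fun ρ ↦ by positivity
  have hc0 : ∀ ρ, 0 ≤ c ρ := fun ρ ↦ by simp only [hc]; split_ifs <;> positivity
  have hc1 : ∀ ρ, c ρ ≤ μ + 1 := fun ρ ↦ by
    simp only [hc]; split_ifs <;> linarith
  have hgs : Summable g := summable_mult_mul_kernelR' t
  have hMs : Summable M := by
    refine Summable.of_nonneg_of_le (fun ρ ↦ by positivity) (fun ρ ↦ ?_)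
      ((hgs.mul_left (μ + 1)).mul_left (4 * x ^ (1 / 2 : ℝ)))
    exact mul_le_mul_of_nonneg_left (mul_le_mul_of_nonneg_right (hc1 ρ) (hg0 ρ)) (by positivity)
  -- termwise: `‖term ρ‖ ≤ M ρ`
  have hterm : ∀ ρ : ZetaZeros.riemannZetaNontrivialZeros, ‖zeroKernelTerm x t ρ‖ ≤ M ρ := by
    intro ρ
    simp only [hM, hc]
    split_ifs with hle
    · have h := norm_zeroKernelTerm_le_factor hx t ρ.2 (hθ ρ ρ.2 hle)
      have e : x ^ (θ - 1 / 2) = x ^ (1 / 2 : ℝ) * μ := by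
        rw [hμ, ← Real.rpow_add hx0]; congr 1; ring
      rw [e] at h
      calc ‖zeroKernelTerm x t ρ‖ ≤ 4 * (x ^ (1 / 2 : ℝ) * μ) * g ρ := h
        _ = 4 * x ^ (1 / 2 : ℝ) * (μ * g ρ) := by ring
    · have h := norm_zeroKernelTerm_le_factor hx t ρ.2
        (ZetaZeros.riemannZetaNontrivialZeros.re_lt_one ρ.2).le
      have e : x ^ ((1 : ℝ) - 1 / 2) = x ^ (1 / 2 : ℝ) := by norm_num
      rw [e] at h
      simpa [hg] using h
  -- the splitting `S − S₁ = Σ'_{ρ ∉ F} term`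
  have hsum := summable_zeroKernelTerm hx t
  have hS₁ : ∑ ρ ∈ F, zeroKernelTerm x t ρ = zeroKernelSum (zerosUpTo T) x t := by
    rw [hF, sum_upToFinset_eq (zeroKernelTerm x t) T]
    rfl
  have hsplit : zeroKernelSeries x t - zeroKernelSum (zerosUpTo T) x t =
      ∑' ρ : {ρ // ρ ∉ F}, zeroKernelTerm x t ρ := by
    rw [← hS₁, zeroKernelSeries, ← hsum.sum_add_tsum_subtype_compl F]
    ring
  -- norm of the tail
  have hns : Summable fun ρ : {ρ // ρ ∉ F} ↦ ‖zeroKernelTerm x t ρ‖ :=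
    (summable_norm_zeroKernelTerm hx t).subtype _
  have hMs' : Summable fun ρ : {ρ // ρ ∉ F} ↦ M ρ := hMs.subtype _
  have h1 : ‖zeroKernelSeries x t - zeroKernelSum (zerosUpTo T) x t‖ ≤ ∑' ρ : {ρ // ρ ∉ F}, M ρ := by
    rw [hsplit]
    exact (norm_tsum_le_tsum_norm hns).trans (hns.tsum_le_tsum (fun ρ ↦ hterm ρ) hMs')
  -- `Σ'_{∉F} M = Σ' M − Σ_F M`
  have h2 : ∑' ρ : {ρ // ρ ∉ F}, M ρ = ∑' ρ, M ρ - ∑ ρ ∈ F, M ρ := by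
    rw [← hMs.sum_add_tsum_subtype_compl F]; ring
  -- `Σ' M = 4x^{1/2}(μ A + (Tot − A))`, `A = Σ_{F_Z} g`, `Tot = Σ' g`
  have h3 : ∑' ρ, M ρ = 4 * x ^ (1 / 2 : ℝ) * (μ * ∑ ρ ∈ FZ, g ρ + (∑' ρ, g ρ - ∑ ρ ∈ FZ, g ρ)) := by
    have hA : ∑ ρ ∈ FZ, M ρ = 4 * x ^ (1 / 2 : ℝ) * (μ * ∑ ρ ∈ FZ, g ρ) := by
      rw [Finset.mul_sum, Finset.mul_sum]
      refine Finset.sum_congr rfl fun ρ hρ ↦ ?_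
      have : |(ρ : ℂ).im| ≤ Z := mem_weilZeroFinset.1 hρ
      simp only [hM, hc, if_pos this]
    have hB : ∑' ρ : {ρ // ρ ∉ FZ}, M ρ = 4 * x ^ (1 / 2 : ℝ) * ∑' ρ : {ρ // ρ ∉ FZ}, g ρ := by
      rw [← tsum_mul_left]
      refine tsum_congr fun ρ ↦ ?_
      have : ¬ |((ρ : ZetaZeros.riemannZetaNontrivialZeros) : ℂ).im| ≤ Z :=
        fun h ↦ ρ.2 (mem_weilZeroFinset.2 h)
      simp only [hM, hc, if_neg this]
      ring
    have hC : ∑' ρ : {ρ // ρ ∉ FZ}, g ρ = ∑' ρ, g ρ - ∑ ρ ∈ FZ, g ρ := by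
      rw [← hgs.sum_add_tsum_subtype_compl FZ]; ring
    rw [← hMs.sum_add_tsum_subtype_compl FZ, hA, hB, hC]
    ring
  -- `Σ_F M = 4x^{1/2} μ D₀`
  have h4 : ∑ ρ ∈ F, M ρ = 4 * x ^ (1 / 2 : ℝ) *
      (μ * ∑ n ∈ Finset.range (zetaZeroCount T), 1 / (1 + (t - zetaOrdinate n) ^ 2)) := by
    have hFμ : ∀ ρ ∈ F, M ρ = 4 * x ^ (1 / 2 : ℝ) * (μ * g ρ) := by
      intro ρ hρ
      have : |(ρ : ℂ).im| ≤ Z := mem_weilZeroFinset.1 (hFsub hρ)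
      simp only [hM, hc, if_pos this]
    rw [Finset.sum_congr rfl hFμ, ← Finset.mul_sum, ← Finset.mul_sum]
    congr 2
    have e := sum_zerosUpTo_mult_mul_eq (fun u ↦ 1 / (1 + (t - u) ^ 2)) T
    rw [← e, hF, sum_upToFinset_eq (fun z ↦ (mult z : ℝ) * (1 / (1 + (t - z.im) ^ 2))) T]
  -- dictionaries for `A` and `Tot`
  have h5 : ∑ ρ ∈ FZ, g ρ = truncDensity Z t := by
    have e := sum_weilZeroFinset_mult_mul_eq (fun u ↦ 1 / (1 + (t - u) ^ 2)) Z
    simp only [sub_neg_eq_add] at e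
    simp only [hg, hFZ]
    rw [e, truncDensity]
  have h6 : ∑' ρ, g ρ = truncDensity Z t + farDensity Z t := by
    rw [truncDensity_add_farDensity']
    simp only [hg]
    exact tsum_mult_mul_kernelR_eq t
  -- assemble
  calc ‖zeroKernelSeries x t - zeroKernelSum (zerosUpTo T) x t‖
      ≤ ∑' ρ : {ρ // ρ ∉ F}, M ρ := h1
    _ = 4 * x ^ (1 / 2 : ℝ) * (μ * (truncDensity Z t -
          ∑ n ∈ Finset.range (zetaZeroCount T), 1 / (1 + (t - zetaOrdinate n) ^ 2)) +
          farDensity Z t) := by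
        rw [h2, h3, h4, h5, h6]; ring

/-- The box density is part of the truncated density: `D₀ ≤ A_Z` for `T ≤ Z`.
[cite: BaluyotEtAl2024, §2 (trivialestimate)] -/
theorem sum_range_kernel_le_truncDensity {T Z : ℝ} (hTZ : T ≤ Z) (t : ℝ) :
    ∑ n ∈ Finset.range (zetaZeroCount T), 1 / (1 + (t - zetaOrdinate n) ^ 2) ≤ truncDensity Z t := by
  unfold truncDensity
  have hsub : Finset.range (zetaZeroCount T) ⊆ Finset.range (zetaZeroCount Z) :=
    Finset.range_mono (zetaZeroCount_mono hTZ)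
  calc ∑ n ∈ Finset.range (zetaZeroCount T), 1 / (1 + (t - zetaOrdinate n) ^ 2)
      ≤ ∑ n ∈ Finset.range (zetaZeroCount Z), 1 / (1 + (t - zetaOrdinate n) ^ 2) :=
        Finset.sum_le_sum_of_subset_of_nonneg hsub fun n _ _ ↦ by positivity
    _ ≤ ∑ n ∈ Finset.range (zetaZeroCount Z),
        (1 / (1 + (t - zetaOrdinate n) ^ 2) + 1 / (1 + (t + zetaOrdinate n) ^ 2)) :=
        Finset.sum_le_sum fun n _ ↦ by
          have : (0 : ℝ) ≤ 1 / (1 + (t + zetaOrdinate n) ^ 2) := by positivity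
          linarith

/-! ## §3. `L¹` bounds for the box density and the near density ((Za)–(Zd) at height `T`) -/

/-- `∫_a^b dt/(1+(t−c)²) = arctan(b−c) − arctan(a−c)`. [folklore] -/
private theorem integral_kernelR' (a b c : ℝ) :
    ∫ t in a..b, 1 / (1 + (t - c) ^ 2) = Real.arctan (b - c) - Real.arctan (a - c) :=
  integral_eq_sub_of_hasDerivAt (fun t _ ↦ hasDerivAt_arctan_sub c t)
    ((continuous_const.div (by fun_prop) fun t ↦ by positivity).intervalIntegrable _ _)

/-- Box ordinates lie in `(0, T]`. [folklore] -/
private theorem mem_box_ordinate {T : ℝ} {n : ℕ} (hn : n ∈ Finset.range (zetaZeroCount T)) :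
    0 < zetaOrdinate n ∧ zetaOrdinate n ≤ T :=
  ⟨zetaOrdinate_pos_holds n, zetaOrdinate_le_iff_lt.2 (Finset.mem_range.1 hn)⟩

/-- The box density is continuous. [folklore] -/
private theorem continuous_sum_range_kernel (T : ℝ) :
    Continuous fun t : ℝ ↦ ∑ n ∈ Finset.range (zetaZeroCount T), 1 / (1 + (t - zetaOrdinate n) ^ 2) :=
  continuous_finsetSum _ fun n _ ↦ continuous_const.div (by fun_prop) fun t ↦ by positivity

/-- The box density is integrable on `ℝ`. [folklore] -/
private theorem integrable_sum_range_kernel (T : ℝ) :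
    Integrable fun t : ℝ ↦ ∑ n ∈ Finset.range (zetaZeroCount T), 1 / (1 + (t - zetaOrdinate n) ^ 2) :=
  integrable_finsetSum _ fun n _ ↦ integrable_firstWeight (zetaOrdinate n)

/-- **`∫_T^∞ D₀ ≪ log²(T+2)`** ((Zc) at height `T`). [cite: Goldston2005, (4.3)] -/
theorem integral_Ioi_sum_range_kernel_le {B : ℝ}
    (hB : ∀ T : ℝ, 2 ≤ T → ∀ s : Finset ℕ, (∀ n ∈ s, zetaOrdinate n ≤ T) →
      ∑ n ∈ s, (π / 2 - Real.arctan (T - zetaOrdinate n)) ≤ B * Real.log (T + 2) ^ 2)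
    {T : ℝ} (hT : 2 ≤ T) :
    ∫ t in Ioi T, ∑ n ∈ Finset.range (zetaZeroCount T), 1 / (1 + (t - zetaOrdinate n) ^ 2) ≤
      B * Real.log (T + 2) ^ 2 := by
  rw [integral_finsetSum _ fun n _ ↦ (integrable_firstWeight (zetaOrdinate n)).integrableOn]
  simp_rw [integral_Ioi_firstWeight]
  exact hB T hT _ fun n hn ↦ (mem_box_ordinate hn).2

/-- **`∫_{−∞}^0 D₀ ≪ log²(T+2)`** ((Zd) at height `T`). [cite: Goldston2005, (4.3)] -/
theorem integral_Iic_sum_range_kernel_le {B : ℝ}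
    (hB : ∀ T : ℝ, 2 ≤ T → ∀ s : Finset ℕ, (∀ n ∈ s, zetaOrdinate n ≤ T) →
      ∑ n ∈ s, (π / 2 - Real.arctan (zetaOrdinate n)) ≤ B * Real.log (T + 2) ^ 2)
    {T : ℝ} (hT : 2 ≤ T) :
    ∫ t in Iic (0 : ℝ), ∑ n ∈ Finset.range (zetaZeroCount T), 1 / (1 + (t - zetaOrdinate n) ^ 2) ≤
      B * Real.log (T + 2) ^ 2 := by
  rw [integral_finsetSum _ fun n _ ↦ (integrable_firstWeight (zetaOrdinate n)).integrableOn]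
  simp_rw [integral_Iic_firstWeight]
  exact hB T hT _ fun n hn ↦ (mem_box_ordinate hn).2

/-- **`∫_0^T (A_Z − D₀) ≪ log²(T+2)`** for `T ≤ Z`: the zeros above the box contribute
`Σ_{γ>T}(arctan γ − arctan(γ−T))` ((Za) at `T`) and the negative ordinates
`Σ_γ (arctan(T+γ) − arctan γ)` ((Zb) at `T`). [cite: Goldston2005, (4.3)] -/
theorem integral_near_upTo_le {Ba Bb : ℝ}
    (hBa : ∀ T : ℝ, 2 ≤ T → ∀ s : Finset ℕ, (∀ n ∈ s, T < zetaOrdinate n) →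
      ∑ n ∈ s, (Real.arctan (zetaOrdinate n) - Real.arctan (zetaOrdinate n - T)) ≤
        Ba * Real.log (T + 2) ^ 2)
    (hBb : ∀ T : ℝ, 2 ≤ T → ∀ s : Finset ℕ,
      ∑ n ∈ s, (Real.arctan (T + zetaOrdinate n) - Real.arctan (zetaOrdinate n)) ≤
        Bb * Real.log (T + 2) ^ 2)
    {T Z : ℝ} (hT : 2 ≤ T) (hTZ : T ≤ Z) :
    ∫ t in (0 : ℝ)..T, (truncDensity Z t -
        ∑ n ∈ Finset.range (zetaZeroCount T), 1 / (1 + (t - zetaOrdinate n) ^ 2)) ≤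
      (Ba + Bb) * Real.log (T + 2) ^ 2 := by
  have hT0 : 0 ≤ T := by linarith
  have hN : zetaZeroCount T ≤ zetaZeroCount Z := zetaZeroCount_mono hTZ
  set g : ℕ → ℝ → ℝ := fun n t ↦ 1 / (1 + (t - zetaOrdinate n) ^ 2) with hg
  set g' : ℕ → ℝ → ℝ := fun n t ↦ 1 / (1 + (t + zetaOrdinate n) ^ 2) with hg'
  have hgc : ∀ n : ℕ, Continuous (g n) := fun n ↦
    continuous_const.div (by fun_prop) fun t ↦ by positivity
  have hg'c : ∀ n : ℕ, Continuous (g' n) := fun n ↦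
    continuous_const.div (by fun_prop) fun t ↦ by positivity
  -- split the near density into the two families of zeros
  have hsplit : ∀ t : ℝ, truncDensity Z t -
      ∑ n ∈ Finset.range (zetaZeroCount T), 1 / (1 + (t - zetaOrdinate n) ^ 2) =
      ∑ n ∈ Finset.Ico (zetaZeroCount T) (zetaZeroCount Z), g n t +
        ∑ n ∈ Finset.range (zetaZeroCount Z), g' n t := by
    intro t
    unfold truncDensity
    rw [Finset.sum_add_distrib]
    have h3 : ∑ n ∈ Finset.range (zetaZeroCount Z), g n t =
        ∑ n ∈ Finset.range (zetaZeroCount T), g n t +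
          ∑ n ∈ Finset.Ico (zetaZeroCount T) (zetaZeroCount Z), g n t := by
      rw [Finset.range_eq_Ico, Finset.range_eq_Ico, Finset.sum_Ico_consecutive _ (Nat.zero_le _) hN]
    simp only [hg, hg'] at h3 ⊢
    rw [h3]
    ring
  have hS2 : IntervalIntegrable
      (fun t ↦ ∑ n ∈ Finset.Ico (zetaZeroCount T) (zetaZeroCount Z), g n t) volume 0 T :=
    (continuous_finsetSum _ fun n _ ↦ hgc n).intervalIntegrable _ _
  have hS3 : IntervalIntegrable (fun t ↦ ∑ n ∈ Finset.range (zetaZeroCount Z), g' n t) volume 0 T :=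
    (continuous_finsetSum _ fun n _ ↦ hg'c n).intervalIntegrable _ _
  have hI2 : ∫ t in (0 : ℝ)..T, ∑ n ∈ Finset.Ico (zetaZeroCount T) (zetaZeroCount Z), g n t =
      ∑ n ∈ Finset.Ico (zetaZeroCount T) (zetaZeroCount Z),
        (Real.arctan (T - zetaOrdinate n) - Real.arctan (0 - zetaOrdinate n)) := by
    rw [intervalIntegral.integral_finsetSum fun n _ ↦ (hgc n).intervalIntegrable _ _]
    exact Finset.sum_congr rfl fun n _ ↦ integral_kernelR' _ _ _
  have hI3 : ∫ t in (0 : ℝ)..T, ∑ n ∈ Finset.range (zetaZeroCount Z), g' n t =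
      ∑ n ∈ Finset.range (zetaZeroCount Z),
        (Real.arctan (T + zetaOrdinate n) - Real.arctan (0 + zetaOrdinate n)) := by
    rw [intervalIntegral.integral_finsetSum fun n _ ↦ (hg'c n).intervalIntegrable _ _]
    refine Finset.sum_congr rfl fun n _ ↦ ?_
    have := integral_kernelR' 0 T (-zetaOrdinate n)
    simp only [sub_neg_eq_add] at this
    simpa [hg'] using this
  -- bounds for the two families
  have hB2 : ∑ n ∈ Finset.Ico (zetaZeroCount T) (zetaZeroCount Z),
      (Real.arctan (T - zetaOrdinate n) - Real.arctan (0 - zetaOrdinate n)) ≤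
      Ba * Real.log (T + 2) ^ 2 := by
    have hmem : ∀ n ∈ Finset.Ico (zetaZeroCount T) (zetaZeroCount Z), T < zetaOrdinate n := by
      intro n hn
      rw [Finset.mem_Ico] at hn
      exact not_le.1 fun h ↦ absurd (zetaOrdinate_le_iff_lt.1 h) (not_lt.2 hn.1)
    refine le_trans (le_of_eq (Finset.sum_congr rfl fun n _ ↦ ?_)) (hBa T hT _ hmem)
    rw [zero_sub, Real.arctan_neg, show T - zetaOrdinate n = -(zetaOrdinate n - T) by ring,
      Real.arctan_neg]
    ring
  have hB3 : ∑ n ∈ Finset.range (zetaZeroCount Z),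
      (Real.arctan (T + zetaOrdinate n) - Real.arctan (0 + zetaOrdinate n)) ≤
      Bb * Real.log (T + 2) ^ 2 := by
    refine le_trans (le_of_eq (Finset.sum_congr rfl fun n _ ↦ by rw [zero_add])) (hBb T hT _)
  simp_rw [hsplit]
  rw [intervalIntegral.integral_add hS2 hS3, hI2, hI3]
  linarith

/-! ## §4. Part A: the box sum off `[0, T]` -/

/-- Powers: `(x^{θ−1/2})² = x^{2θ−1}`. [folklore] -/
private theorem rpow_sub_half_sq' {x : ℝ} (hx : 0 < x) (θ : ℝ) :
    (x ^ (θ - 1 / 2)) ^ 2 = x ^ (2 * θ - 1) := by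
  rw [sq, ← Real.rpow_add hx]; congr 1; ring

/-- **Part A (window `0 < γ ≤ T`).** Off `[0,T]` the mean square of `S₁` is small: for `T ≥ 2`, `x ≥ 1`
and `Re ρ ≤ θ` on the box, `0 ≤ ∫_ℝ ‖S₁‖² − ∫_0^T ‖S₁‖² ≤ (256 C₀ B_d + 128 C₀ B_c) x^{2θ−1} log³(T+2)` —
by `‖S₁‖² ≤ 16x^{2θ−1} D₀²`, the sup bounds (KB3)–(KB4) and the `L¹` bounds (Zc), (Zd) (Montgomery: "the
range of integration can be extended to `ℝ` with a small error").
[cite: BaluyotEtAl2024, Lemma 4 (proof: «Montgomery's argument»)] -/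
theorem integral_compl_upTo_le {C₀ Bc Bd : ℝ} (hC₀ : 0 ≤ C₀)
    (hW : ∀ u : ℝ, (zetaZeroCount (u + 1) : ℝ) - zetaZeroCount u ≤ C₀ * Real.log (|u| + 2))
    (hBc : ∀ T : ℝ, 2 ≤ T → ∀ s : Finset ℕ, (∀ n ∈ s, zetaOrdinate n ≤ T) →
      ∑ n ∈ s, (π / 2 - Real.arctan (T - zetaOrdinate n)) ≤ Bc * Real.log (T + 2) ^ 2)
    (hBd : ∀ T : ℝ, 2 ≤ T → ∀ s : Finset ℕ, (∀ n ∈ s, zetaOrdinate n ≤ T) →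
      ∑ n ∈ s, (π / 2 - Real.arctan (zetaOrdinate n)) ≤ Bd * Real.log (T + 2) ^ 2)
    {x : ℝ} (hx : 1 ≤ x) {T θ : ℝ} (hT : 2 ≤ T) (hθ : ∀ ρ ∈ zerosUpTo T, ρ.re ≤ θ) :
    0 ≤ (∫ t : ℝ, ‖zeroKernelSum (zerosUpTo T) x t‖ ^ 2) -
        ∫ t in (0 : ℝ)..T, ‖zeroKernelSum (zerosUpTo T) x t‖ ^ 2 ∧
      (∫ t : ℝ, ‖zeroKernelSum (zerosUpTo T) x t‖ ^ 2) -
          ∫ t in (0 : ℝ)..T, ‖zeroKernelSum (zerosUpTo T) x t‖ ^ 2 ≤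
        (256 * C₀ * Bd + 128 * C₀ * Bc) * x ^ (2 * θ - 1) * Real.log (T + 2) ^ 3 := by
  have hx0 : 0 < x := one_pos.trans_le hx
  have hT0 : 0 ≤ T := by linarith
  set L : ℝ := Real.log (T + 2) with hL
  have hL1 : 1 ≤ L := by
    rw [hL, ← Real.log_exp 1]
    exact Real.log_le_log (Real.exp_pos 1) (by linarith [Real.exp_one_lt_d9])
  have hL0 : 0 ≤ L := by linarith
  set f : ℝ → ℝ := fun t ↦ ‖zeroKernelSum (zerosUpTo T) x t‖ ^ 2 with hf
  set D : ℝ → ℝ := fun t ↦ ∑ n ∈ Finset.range (zetaZeroCount T), 1 / (1 + (t - zetaOrdinate n) ^ 2)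
    with hD
  have hfi : Integrable f :=
    integrable_norm_zeroKernelSum_sq (zerosUpTo T) (fun ρ hρ ↦ mem_nontrivialZeros_of_mem_zerosUpTo hρ) x
  have hDi : Integrable D := integrable_sum_range_kernel T
  have hf0 : ∀ t, 0 ≤ f t := fun t ↦ by positivity
  have hDnn : ∀ t, 0 ≤ D t := fun t ↦ Finset.sum_nonneg fun _ _ ↦ by positivity
  -- pointwise: `f ≤ 16 x^{2θ−1} D²`
  set P : ℝ := x ^ (2 * θ - 1) with hP
  have hP0 : 0 ≤ P := by positivity
  have hpt : ∀ t : ℝ, f t ≤ 16 * P * D t ^ 2 := by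
    intro t
    have h := norm_zeroKernelSum_zerosUpTo_le hx hθ t
    have h0 : 0 ≤ 4 * x ^ (θ - 1 / 2) * D t := by
      have := hDnn t; positivity
    calc f t = ‖zeroKernelSum (zerosUpTo T) x t‖ ^ 2 := rfl
      _ ≤ (4 * x ^ (θ - 1 / 2) * D t) ^ 2 := pow_le_pow_left₀ (norm_nonneg _) h 2
      _ = 16 * P * D t ^ 2 := by rw [hP, ← rpow_sub_half_sq' hx0]; ring
  -- decomposition `∫ f − ∫_0^T f = ∫_{Iic 0} f + ∫_{Ioi T} f`
  have hdec : (∫ t : ℝ, f t) - ∫ t in (0 : ℝ)..T, f t =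
      (∫ t in Iic (0 : ℝ), f t) + ∫ t in Ioi T, f t := by
    have h1 := (integral_Iic_add_Ioi hfi.integrableOn hfi.integrableOn (b := 0)).symm
    have h2 := (integral_interval_add_Ioi (hfi.integrableOn (s := Ioi 0)) (hfi.integrableOn (s := Ioi T))
      (a := 0) (b := T) (μ := volume) (f := f)).symm
    rw [h1, h2]
    ring
  have hA0 : 0 ≤ ∫ t in Iic (0 : ℝ), f t := setIntegral_nonneg measurableSet_Iic fun t _ ↦ hf0 t
  have hC0' : 0 ≤ ∫ t in Ioi T, f t := setIntegral_nonneg measurableSet_Ioi fun t _ ↦ hf0 t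
  refine ⟨by rw [hdec]; positivity, ?_⟩
  -- piece 1: `t ≤ 0`, `D ≤ 16 C₀`
  have hA : ∫ t in Iic (0 : ℝ), f t ≤ 256 * C₀ * Bd * P * L ^ 2 := by
    have hmono : ∫ t in Iic (0 : ℝ), f t ≤ ∫ t in Iic (0 : ℝ), (16 * P * (16 * C₀)) * D t := by
      refine setIntegral_mono_on hfi.integrableOn ((hDi.const_mul _).integrableOn) measurableSet_Iic
        fun t ht ↦ (hpt t).trans ?_
      have hD0 : 0 ≤ D t := hDnn t
      have hDle : D t ≤ 16 * C₀ := by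
        have h := sum_range_kernel_le_of_nonpos hC₀ hW (t := t) ht T
        refine h.trans ?_
        have hlog : Real.log (|t| + 2) ≤ |t| + 1 := by
          have := Real.log_le_sub_one_of_pos (show 0 < |t| + 2 by positivity)
          linarith
        rw [mul_div_assoc]
        refine mul_le_of_le_one_right (by positivity) ?_
        rw [div_le_one (by positivity)]
        exact hlog
      rw [sq]
      have : D t * D t ≤ 16 * C₀ * D t := mul_le_mul_of_nonneg_right hDle hD0
      nlinarith
    rw [MeasureTheory.integral_const_mul] at hmono
    have hI := integral_Iic_sum_range_kernel_le hBd hT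
    rw [← hL] at hI
    calc ∫ t in Iic (0 : ℝ), f t ≤ 16 * P * (16 * C₀) * ∫ t in Iic (0 : ℝ), D t := hmono
      _ ≤ 16 * P * (16 * C₀) * (Bd * L ^ 2) := mul_le_mul_of_nonneg_left hI (by positivity)
      _ = 256 * C₀ * Bd * P * L ^ 2 := by ring
  -- piece 2: `t ≥ T`, `D ≤ 8 C₀ L`
  have hC : ∫ t in Ioi T, f t ≤ 128 * C₀ * Bc * P * L ^ 3 := by
    have hmono : ∫ t in Ioi T, f t ≤ ∫ t in Ioi T, (16 * P * (8 * C₀ * L)) * D t := by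
      refine setIntegral_mono_on hfi.integrableOn ((hDi.const_mul _).integrableOn) measurableSet_Ioi
        fun t ht ↦ (hpt t).trans ?_
      have hD0 : 0 ≤ D t := hDnn t
      have ht' : T ≤ t := le_of_lt ht
      have hDle : D t ≤ 8 * C₀ * L := by
        refine (sum_range_kernel_le_of_le hC₀ hW hT0 ht').trans ?_
        rw [← hL]
        exact div_le_self (by positivity) (by linarith)
      rw [sq]
      have : D t * D t ≤ 8 * C₀ * L * D t := mul_le_mul_of_nonneg_right hDle hD0
      nlinarith
    rw [MeasureTheory.integral_const_mul] at hmono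
    have hI := integral_Ioi_sum_range_kernel_le hBc hT
    rw [← hL] at hI
    calc ∫ t in Ioi T, f t ≤ 16 * P * (8 * C₀ * L) * ∫ t in Ioi T, D t := hmono
      _ ≤ 16 * P * (8 * C₀ * L) * (Bc * L ^ 2) := mul_le_mul_of_nonneg_left hI (by positivity)
      _ = 128 * C₀ * Bc * P * L ^ 3 := by ring
  have hBd0 : 0 ≤ 256 * C₀ * Bd * P * L ^ 2 := le_trans hA0 hA
  rw [hdec]
  have hL23 : L ^ 2 ≤ L ^ 3 := by nlinarith
  have : 256 * C₀ * Bd * P * L ^ 2 ≤ 256 * C₀ * Bd * P * L ^ 3 := by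
    have hL2 : 0 < L ^ 2 := by positivity
    have hc : 0 ≤ 256 * C₀ * Bd * P :=
      le_of_mul_le_mul_right (by rw [zero_mul]; exact hBd0) hL2
    exact mul_le_mul_of_nonneg_left hL23 hc
  linarith

/-! ## §5. Part B and BGST 2024 Lemma 4 for the window `0 < γ ≤ T` -/

/-- `|a² − b²| ≤ d(d + 2b)` when `|a − b| ≤ d` and `a, b ≥ 0`. [folklore] -/
private theorem abs_sq_sub_sq_le' {a b d : ℝ} (ha : 0 ≤ a) (hb : 0 ≤ b) (h : |a - b| ≤ d) :
    |a ^ 2 - b ^ 2| ≤ d * (d + 2 * b) := by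
  have hd : 0 ≤ d := (abs_nonneg _).trans h
  have hab : a ≤ b + d := by linarith [(abs_le.1 h).2]
  rw [show a ^ 2 - b ^ 2 = (a - b) * (a + b) by ring, abs_mul, abs_of_nonneg (by linarith : 0 ≤ a + b)]
  calc |a - b| * (a + b) ≤ d * (a + b) := mul_le_mul_of_nonneg_right h (by linarith)
    _ ≤ d * (d + 2 * b) := mul_le_mul_of_nonneg_left (by linarith) hd

/-- **BGST 2024, Lemma 4, for the window `0 < γ ≤ T` — the zero side of Theorem 1.** There is an absolute
`C` such that for all `T ≥ 4`, `x ≥ 1` and `θ ≤ 1` with `Re ρ ≤ θ` for every non-trivial zero `ρ` with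
`|Im ρ| ≤ T²`: `|∫_0^T ‖S_u(x,t)‖² dt − (π/2) Re F(x,T)| ≤ C (x^{2θ−1} log³(T+2) + x log²(T+2)/T)`, where
`S_u(x,t) = Σ_ρ m(ρ) x^{ρ−1/2}/(1−(ρ−1/2−it)²)` (all zeros) and `(π/2) Re F(x,T) = ∫_ℝ ‖S₁‖²`,
`S₁ = S_{(0,T]}` (Lemma 3, `integral_norm_zeroKernelSum_zerosUpTo_sq`). In the source: "`L(x,T) = 2πF(x,T) +
O(x^{1−2η(T log²T)} log³T) + O(x)`" with `L = 4x∫_0^T|S_u|²`, `Θ(Z) ≤ 1 − η(Z)`; here `Z = T²`, the bound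
`Θ(Z) ≤ θ` is the hypothesis, and the truncation error is `O(x log²T/T)`.
[cite: BaluyotEtAl2024, Lemma 4] -/
theorem upTo_zeroSide : ∃ C : ℝ, 0 < C ∧ ∀ T : ℝ, 4 ≤ T → ∀ x : ℝ, 1 ≤ x → ∀ θ : ℝ, θ ≤ 1 →
    (∀ ρ ∈ ZetaZeros.riemannZetaNontrivialZeros, |ρ.im| ≤ T ^ 2 → ρ.re ≤ θ) →
      |(∫ t in (0 : ℝ)..T, ‖zeroKernelSeries x t‖ ^ 2) - π / 2 * (pairSum x T).re| ≤
        C * (x ^ (2 * θ - 1) * Real.log (T + 2) ^ 3 + x * Real.log (T + 2) ^ 2 / T) := by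
  obtain ⟨C₀, hC₀pos, hW⟩ := exists_zetaZeroCount_window_le
  have hC₀ : 0 ≤ C₀ := hC₀pos.le
  obtain ⟨Ba, hBa0, hBa⟩ := exists_sum_arctan_sub_arctan_sub_le
  obtain ⟨Bb, hBb0, hBb⟩ := exists_sum_arctan_add_sub_arctan_le
  obtain ⟨Bc, hBc0, hBc⟩ := exists_sum_pi_div_two_sub_arctan_sub_le
  obtain ⟨Bd, hBd0, hBd⟩ := exists_sum_pi_div_two_sub_arctan_le
  refine ⟨(256 * C₀ * Bd + 128 * C₀ * Bc) + 32 * (104 * C₀) * (Ba + Bb) +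
    32 * 128 * 152 * C₀ ^ 2 + 1, by positivity, fun T hT x hx θ hθ1 hθ ↦ ?_⟩
  have hCA0 : 0 ≤ 256 * C₀ * Bd + 128 * C₀ * Bc := by positivity
  have hCB0 : 0 ≤ 32 * (104 * C₀) * (Ba + Bb) := by positivity
  have hCF0 : 0 ≤ 32 * 128 * 152 * C₀ ^ 2 := by positivity
  have hBsum0 : 0 ≤ Ba + Bb := by positivity
  -- basic quantities
  have hx0 : 0 < x := one_pos.trans_le hx
  have hT2 : 2 ≤ T := by linarith
  have hT0 : 0 ≤ T := by linarith
  have hT1 : 1 ≤ T := by linarith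
  have hTpos : 0 < T := by linarith
  -- the truncation height `Z = T²`
  set Z : ℝ := T ^ 2 with hZ
  have hTZ : T ≤ Z := by rw [hZ]; nlinarith
  have hZT : T ^ 2 / 2 ≤ Z - T + 1 := by rw [hZ]; nlinarith
  have hZT0 : 0 < Z - T + 1 := by
    have : 0 < T ^ 2 / 2 := by positivity
    linarith
  have hZle : Z + 2 ≤ (T + 2) ^ 2 := by rw [hZ]; nlinarith
  clear_value Z
  -- the logarithms `L = log(T+2) ≥ 1` and `LZ = log(Z+2) ≤ 2L`
  set L : ℝ := Real.log (T + 2) with hL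
  have hL1 : 1 ≤ L := by
    rw [hL, ← Real.log_exp 1]
    exact Real.log_le_log (Real.exp_pos 1) (by linarith [Real.exp_one_lt_d9])
  have hL0 : 0 ≤ L := by linarith
  set LZ : ℝ := Real.log (Z + 2) with hLZ
  have hLZ0 : 0 ≤ LZ := by rw [hLZ]; exact Real.log_nonneg (by linarith)
  have hLZle : LZ ≤ 2 * L := by
    have e : Real.log ((T + 2) ^ 2) = 2 * L := by
      rw [Real.log_pow, hL]; push_cast; ring
    rw [hLZ, ← e]
    exact Real.log_le_log (by linarith) hZle
  clear_value L LZ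
  -- `μ = x^{θ−1} ≤ 1`
  set μ : ℝ := x ^ (θ - 1) with hμ
  have hμ0 : 0 ≤ μ := by rw [hμ]; exact Real.rpow_nonneg hx0.le _
  have hμ1 : μ ≤ 1 := by rw [hμ]; exact Real.rpow_le_one_of_one_le_of_nonpos hx (by linarith)
  have hxhalf : x ^ (θ - 1 / 2) = x ^ (1 / 2 : ℝ) * μ := by
    rw [hμ, ← Real.rpow_add hx0]; congr 1; ring
  have hxsq : x ^ (1 / 2 : ℝ) * x ^ (1 / 2 : ℝ) = x := by
    rw [← Real.rpow_add hx0]; norm_num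
  have hx12 : 0 ≤ x ^ (1 / 2 : ℝ) := Real.rpow_nonneg hx0.le _
  have hxμ : x ^ (2 * θ - 1) = x * μ ^ 2 := by
    rw [show 2 * θ - 1 = 1 + (θ - 1) + (θ - 1) by ring, Real.rpow_add hx0, Real.rpow_add hx0,
      Real.rpow_one, hμ]
    ring
  have hP0 : 0 ≤ x ^ (2 * θ - 1) := Real.rpow_nonneg hx0.le _
  clear_value μ
  -- the box hypothesis
  have hθW : ∀ ρ ∈ zerosUpTo T, ρ.re ≤ θ := by
    intro ρ hρ
    refine hθ ρ (mem_nontrivialZeros_of_mem_zerosUpTo hρ) ?_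
    rw [mem_zerosUpTo] at hρ
    have h1 := hρ.2.2.2
    rw [abs_of_pos h1.1]
    exact h1.2.trans hTZ
  -- the box density
  set D : ℝ → ℝ := fun t ↦ ∑ n ∈ Finset.range (zetaZeroCount T), 1 / (1 + (t - zetaOrdinate n) ^ 2)
    with hD
  have hDnn : ∀ t, 0 ≤ D t := fun t ↦ Finset.sum_nonneg fun _ _ ↦ by positivity
  -- constants on `[0, T]`: `D₁` (sup of `D₀`), `N₁` (sup of the near density), `Φ` (sup of the far one)
  set D₁ : ℝ := 24 * C₀ * L with hD₁
  set N₁ : ℝ := 40 * C₀ * LZ with hN₁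
  set Φ : ℝ := 32 * C₀ * LZ / (Z - T + 1) with hΦ
  have h32 : 0 ≤ 32 * C₀ * LZ := mul_nonneg (mul_nonneg (by norm_num) hC₀) hLZ0
  have h128 : 0 ≤ 128 * C₀ * L := mul_nonneg (mul_nonneg (by norm_num) hC₀) hL0
  have hD₁0 : 0 ≤ D₁ := by rw [hD₁]; exact mul_nonneg (mul_nonneg (by norm_num) hC₀) hL0
  have hN₁0 : 0 ≤ N₁ := by rw [hN₁]; exact mul_nonneg (mul_nonneg (by norm_num) hC₀) hLZ0
  have hΦ0 : 0 ≤ Φ := by rw [hΦ]; exact div_nonneg h32 hZT0.le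
  have hND : N₁ + D₁ ≤ 104 * C₀ * L := by
    rw [hN₁, hD₁]
    have := mul_le_mul_of_nonneg_left hLZle (mul_nonneg (by norm_num : (0 : ℝ) ≤ 40) hC₀)
    linarith
  set Φm : ℝ := 128 * C₀ * L / T ^ 2 with hΦm
  have hΦle : Φ ≤ Φm := by
    rw [hΦ, hΦm, div_le_div_iff₀ hZT0 (pow_pos hTpos 2)]
    calc 32 * C₀ * LZ * T ^ 2 ≤ 64 * C₀ * L * T ^ 2 := by
          have : 32 * C₀ * LZ ≤ 64 * C₀ * L := by
            have := mul_le_mul_of_nonneg_left hLZle (mul_nonneg (by norm_num : (0 : ℝ) ≤ 32) hC₀)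
            linarith
          exact mul_le_mul_of_nonneg_right this (pow_nonneg hT0 2)
      _ = 128 * C₀ * L * (T ^ 2 / 2) := by ring
      _ ≤ 128 * C₀ * L * (Z - T + 1) := mul_le_mul_of_nonneg_left hZT h128
  have hΦm0 : 0 ≤ Φm := by rw [hΦm]; exact div_nonneg h128 (pow_nonneg hT0 2)
  have hΦmle : Φm ≤ 128 * C₀ * L := by
    rw [hΦm]
    exact div_le_self h128 (one_le_pow₀ hT1)
  have hΦmT : Φm * T = 128 * C₀ * L / T := by
    rw [hΦm, div_mul_eq_mul_div, pow_two, mul_div_mul_right _ _ hTpos.ne']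
  clear_value D₁ N₁ Φ Φm
  -- pointwise bounds on `[0, T]`
  have hNear0 : ∀ t, 0 ≤ truncDensity Z t - D t :=
    fun t ↦ sub_nonneg.2 (sum_range_kernel_le_truncDensity hTZ t)
  have hNearle : ∀ t ∈ Icc 0 T, truncDensity Z t - D t ≤ N₁ := by
    intro t ht
    have h1 := truncDensity_le hC₀ hW (Z := Z) (t := t) ht.1 (ht.2.trans hTZ)
    rw [← hLZ] at h1
    have h2 := hDnn t
    rw [hN₁]
    linarith
  have hS₁le : ∀ t ∈ Icc 0 T,
      ‖zeroKernelSum (zerosUpTo T) x t‖ ≤ 4 * x ^ (1 / 2 : ℝ) * μ * D₁ := by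
    intro t ht
    have h := norm_zeroKernelSum_zerosUpTo_le hx hθW t
    have hD' := sum_range_kernel_le_of_mem_Icc hC₀ hW (t := t) (T := T) ht.1 ht.2
    rw [← hL] at hD'
    rw [hxhalf] at h
    refine h.trans ?_
    rw [hD₁]
    have : 0 ≤ 4 * (x ^ (1 / 2 : ℝ) * μ) := mul_nonneg (by norm_num) (mul_nonneg hx12 hμ0)
    calc 4 * (x ^ (1 / 2 : ℝ) * μ) * D t
        ≤ 4 * (x ^ (1 / 2 : ℝ) * μ) * (24 * C₀ * L) := mul_le_mul_of_nonneg_left hD' this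
      _ = 4 * x ^ (1 / 2 : ℝ) * μ * (24 * C₀ * L) := by ring
  have hdle : ∀ t ∈ Icc 0 T, ‖zeroKernelSeries x t - zeroKernelSum (zerosUpTo T) x t‖ ≤
      4 * x ^ (1 / 2 : ℝ) * (μ * (truncDensity Z t - D t) + Φ) := by
    intro t ht
    have h := norm_zeroKernelSeries_sub_zerosUpTo_le hx hTZ hθ t
    rw [← hμ] at h
    have hF0 := farDensity_le hC₀ hW (Z := Z) (t := t) ht.1 (ht.2.trans hTZ)
    rw [← hLZ] at hF0
    have hF : farDensity Z t ≤ Φ := by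
      refine hF0.trans ?_
      rw [hΦ]
      exact div_le_div_of_nonneg_left h32 hZT0 (by linarith [ht.2])
    refine h.trans (mul_le_mul_of_nonneg_left (by linarith) (mul_nonneg (by norm_num) hx12))
  -- the majorant `K₁ · Near + K₂` on `[0, T]`
  set K₁ : ℝ := 32 * x * μ ^ 2 * (N₁ + D₁) with hK₁
  set K₂ : ℝ := 32 * x * (Φ ^ 2 + μ * D₁ * Φ) with hK₂
  have hK₁0 : 0 ≤ K₁ := by
    rw [hK₁]
    exact mul_nonneg (mul_nonneg (mul_nonneg (by norm_num) hx0.le) (sq_nonneg μ)) (add_nonneg hN₁0 hD₁0)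
  have hK₂0 : 0 ≤ K₂ := by
    rw [hK₂]
    exact mul_nonneg (mul_nonneg (by norm_num) hx0.le)
      (add_nonneg (sq_nonneg Φ) (mul_nonneg (mul_nonneg hμ0 hD₁0) hΦ0))
  clear_value K₁ K₂
  have hG : ∀ t ∈ Icc 0 T,
      |‖zeroKernelSeries x t‖ ^ 2 - ‖zeroKernelSum (zerosUpTo T) x t‖ ^ 2| ≤
        K₁ * (truncDensity Z t - D t) + K₂ := by
    intro t ht
    have h1 := abs_sq_sub_sq_le' (norm_nonneg (zeroKernelSeries x t))
      (norm_nonneg (zeroKernelSum (zerosUpTo T) x t)) ((abs_norm_sub_norm_le _ _).trans (hdle t ht))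
    refine h1.trans ?_
    have hb := hS₁le t ht
    have hN := hNearle t ht
    have hN0 := hNear0 t
    obtain ⟨Nr, hNr⟩ : ∃ Nr : ℝ, truncDensity Z t - D t = Nr := ⟨_, rfl⟩
    rw [hNr] at h1 hN hN0 ⊢
    obtain ⟨E, hE⟩ : ∃ E : ℝ, μ * Nr + Φ = E := ⟨_, rfl⟩
    rw [hE]
    have hE0 : 0 ≤ E := by rw [← hE]; exact add_nonneg (mul_nonneg hμ0 hN0) hΦ0
    have hδ0 : 0 ≤ 4 * x ^ (1 / 2 : ℝ) * E := mul_nonneg (mul_nonneg (by norm_num) hx12) hE0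
    have hE2 : E ^ 2 ≤ 2 * μ ^ 2 * (N₁ * Nr) + 2 * Φ ^ 2 := by
      have h1 : E ^ 2 ≤ 2 * (μ * Nr) ^ 2 + 2 * Φ ^ 2 := by
        rw [← hE]
        have e : (μ * Nr + Φ) ^ 2 = 2 * (μ * Nr) ^ 2 + 2 * Φ ^ 2 - (μ * Nr - Φ) ^ 2 := by ring
        rw [e]
        linarith [sq_nonneg (μ * Nr - Φ)]
      have h2 : (μ * Nr) ^ 2 ≤ μ ^ 2 * (N₁ * Nr) := by
        rw [mul_pow, sq Nr]
        exact mul_le_mul_of_nonneg_left (mul_le_mul_of_nonneg_right hN hN0) (sq_nonneg μ)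
      linarith
    have h16 : 0 ≤ 16 * x := mul_nonneg (by norm_num) hx0.le
    calc 4 * x ^ (1 / 2 : ℝ) * E * (4 * x ^ (1 / 2 : ℝ) * E + 2 * ‖zeroKernelSum (zerosUpTo T) x t‖)
        ≤ 4 * x ^ (1 / 2 : ℝ) * E * (4 * x ^ (1 / 2 : ℝ) * E + 2 * (4 * x ^ (1 / 2 : ℝ) * μ * D₁)) :=
          mul_le_mul_of_nonneg_left (by linarith) hδ0
      _ = 16 * (x ^ (1 / 2 : ℝ) * x ^ (1 / 2 : ℝ)) * (E ^ 2 + 2 * μ * D₁ * E) := by ring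
      _ = 16 * x * E ^ 2 + 16 * x * (2 * μ * D₁ * E) := by rw [hxsq]; ring
      _ ≤ 16 * x * (2 * μ ^ 2 * (N₁ * Nr) + 2 * Φ ^ 2) + 16 * x * (2 * μ * D₁ * E) := by
          have := mul_le_mul_of_nonneg_left hE2 h16
          linarith
      _ = K₁ * Nr + K₂ := by rw [hK₁, hK₂, ← hE]; ring
  -- integrability on `[0, T]`
  have hZnt : ∀ ρ ∈ zerosUpTo T, ρ ∈ ZetaZeros.riemannZetaNontrivialZeros :=
    fun ρ hρ ↦ mem_nontrivialZeros_of_mem_zerosUpTo hρ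
  have hTle : (0 : ℝ) ≤ T := hT0
  have hSint : IntervalIntegrable (fun t ↦ ‖zeroKernelSeries x t‖ ^ 2) volume 0 T := by
    refine ContinuousOn.intervalIntegrable ?_
    rw [uIcc_of_le hTle]
    exact ((continuousOn_zeroKernelSeries hx 0 T).norm).pow 2
  have hS₁int : IntervalIntegrable (fun t ↦ ‖zeroKernelSum (zerosUpTo T) x t‖ ^ 2) volume 0 T :=
    (((continuous_zeroKernelSum _ hZnt x).norm).pow 2).intervalIntegrable _ _
  have hDc : Continuous D := by rw [hD]; exact continuous_sum_range_kernel T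
  have hNc : Continuous fun t ↦ truncDensity Z t - D t := (continuous_truncDensity Z).sub hDc
  have hGint : IntervalIntegrable (fun t ↦ K₁ * (truncDensity Z t - D t) + K₂) volume 0 T :=
    ((continuous_const.mul hNc).add continuous_const).intervalIntegrable _ _
  -- Part B: on `[0, T]`
  have hnear := integral_near_upTo_le hBa hBb hT2 hTZ
  rw [← hL] at hnear
  have hIG : ∫ t in (0 : ℝ)..T, (K₁ * (truncDensity Z t - D t) + K₂) =
      K₁ * (∫ t in (0 : ℝ)..T, (truncDensity Z t - D t)) + K₂ * T := by
    have hI1 : IntervalIntegrable (fun t ↦ K₁ * (truncDensity Z t - D t)) volume 0 T :=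
      (continuous_const.mul hNc).intervalIntegrable _ _
    have hI2 : IntervalIntegrable (fun _ ↦ K₂) volume 0 T := continuous_const.intervalIntegrable _ _
    rw [intervalIntegral.integral_add hI1 hI2, intervalIntegral.integral_const_mul,
      intervalIntegral.integral_const, smul_eq_mul]
    ring
  have hPartB : |(∫ t in (0 : ℝ)..T, ‖zeroKernelSeries x t‖ ^ 2) -
      ∫ t in (0 : ℝ)..T, ‖zeroKernelSum (zerosUpTo T) x t‖ ^ 2| ≤
      K₁ * ((Ba + Bb) * L ^ 2) + K₂ * T := by
    rw [← intervalIntegral.integral_sub hSint hS₁int]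
    have h := intervalIntegral.norm_integral_le_of_norm_le hTle
      (f := fun t ↦ ‖zeroKernelSeries x t‖ ^ 2 - ‖zeroKernelSum (zerosUpTo T) x t‖ ^ 2)
      (g := fun t ↦ K₁ * (truncDensity Z t - D t) + K₂) (μ := volume)
      (ae_of_all _ fun t ht ↦ ?_) hGint
    · rw [Real.norm_eq_abs, hIG] at h
      refine h.trans ?_
      have hnear' : ∫ t in (0 : ℝ)..T, (truncDensity Z t - D t) ≤ (Ba + Bb) * L ^ 2 := by
        rw [hD]; exact hnear
      have := mul_le_mul_of_nonneg_left hnear' hK₁0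
      linarith
    · rw [Real.norm_eq_abs]
      exact hG t (Ioc_subset_Icc_self ht)
  -- Part A (off `[0,T]`) and Lemma 3
  have hPartA := integral_compl_upTo_le hC₀ hW hBc hBd hx hT2 hθW
  have hL3 := integral_norm_zeroKernelSum_zerosUpTo_sq hx0 T
  -- numerical bookkeeping
  have hK₁le : K₁ * ((Ba + Bb) * L ^ 2) ≤
      32 * (104 * C₀) * (Ba + Bb) * x ^ (2 * θ - 1) * L ^ 3 := by
    have h1 : K₁ ≤ 32 * x ^ (2 * θ - 1) * (104 * C₀ * L) := by
      rw [hK₁, hxμ]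
      have h0 : 0 ≤ 32 * x * μ ^ 2 := mul_nonneg (mul_nonneg (by norm_num) hx0.le) (sq_nonneg μ)
      calc 32 * x * μ ^ 2 * (N₁ + D₁) ≤ 32 * x * μ ^ 2 * (104 * C₀ * L) :=
            mul_le_mul_of_nonneg_left hND h0
        _ = 32 * (x * μ ^ 2) * (104 * C₀ * L) := by ring
    have hB0 : 0 ≤ (Ba + Bb) * L ^ 2 := mul_nonneg hBsum0 (sq_nonneg L)
    calc K₁ * ((Ba + Bb) * L ^ 2)
        ≤ 32 * x ^ (2 * θ - 1) * (104 * C₀ * L) * ((Ba + Bb) * L ^ 2) :=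
          mul_le_mul_of_nonneg_right h1 hB0
      _ = 32 * (104 * C₀) * (Ba + Bb) * x ^ (2 * θ - 1) * L ^ 3 := by ring
  have hK₂le : K₂ * T ≤ 32 * 128 * 152 * C₀ ^ 2 * (x * L ^ 2 / T) := by
    have h1 : Φ ^ 2 + μ * D₁ * Φ ≤ Φm * (Φm + D₁) := by
      have ha : Φ ^ 2 ≤ Φm ^ 2 := pow_le_pow_left₀ hΦ0 hΦle 2
      have hb : μ * D₁ * Φ ≤ D₁ * Φm := by
        calc μ * D₁ * Φ ≤ 1 * D₁ * Φ :=
              mul_le_mul_of_nonneg_right (mul_le_mul_of_nonneg_right hμ1 hD₁0) hΦ0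
          _ ≤ D₁ * Φm := by rw [one_mul]; exact mul_le_mul_of_nonneg_left hΦle hD₁0
      calc Φ ^ 2 + μ * D₁ * Φ ≤ Φm ^ 2 + D₁ * Φm := add_le_add ha hb
        _ = Φm * (Φm + D₁) := by ring
    have h2 : Φm * (Φm + D₁) ≤ Φm * (152 * C₀ * L) := by
      refine mul_le_mul_of_nonneg_left ?_ hΦm0
      rw [hD₁]; linarith
    have h12 := h1.trans h2
    have hxT : 0 ≤ 32 * x * T := mul_nonneg (mul_nonneg (by norm_num) hx0.le) hT0
    calc K₂ * T = 32 * x * T * (Φ ^ 2 + μ * D₁ * Φ) := by rw [hK₂]; ring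
      _ ≤ 32 * x * T * (Φm * (152 * C₀ * L)) := mul_le_mul_of_nonneg_left h12 hxT
      _ = 32 * x * (Φm * T) * (152 * C₀ * L) := by ring
      _ = 32 * 128 * 152 * C₀ ^ 2 * (x * L ^ 2 / T) := by rw [hΦmT]; ring
  -- combine
  have hmain : |(∫ t in (0 : ℝ)..T, ‖zeroKernelSeries x t‖ ^ 2) - π / 2 * (pairSum x T).re| ≤
      32 * (104 * C₀) * (Ba + Bb) * x ^ (2 * θ - 1) * L ^ 3 +
        32 * 128 * 152 * C₀ ^ 2 * (x * L ^ 2 / T) +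
        (256 * C₀ * Bd + 128 * C₀ * Bc) * x ^ (2 * θ - 1) * L ^ 3 := by
    have e : (∫ t in (0 : ℝ)..T, ‖zeroKernelSeries x t‖ ^ 2) - π / 2 * (pairSum x T).re =
        ((∫ t in (0 : ℝ)..T, ‖zeroKernelSeries x t‖ ^ 2) -
            ∫ t in (0 : ℝ)..T, ‖zeroKernelSum (zerosUpTo T) x t‖ ^ 2) -
          ((∫ t : ℝ, ‖zeroKernelSum (zerosUpTo T) x t‖ ^ 2) -
            ∫ t in (0 : ℝ)..T, ‖zeroKernelSum (zerosUpTo T) x t‖ ^ 2) := by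
      rw [← hL3]; ring
    have hA2 := hPartA.2
    rw [← hL] at hA2
    rw [e]
    refine (abs_sub _ _).trans ?_
    rw [abs_of_nonneg hPartA.1]
    linarith [hPartB, hA2, hK₁le, hK₂le]
  refine hmain.trans ?_
  have h1 : 0 ≤ x ^ (2 * θ - 1) * L ^ 3 := mul_nonneg hP0 (pow_nonneg hL0 3)
  have h2 : 0 ≤ x * L ^ 2 / T := div_nonneg (mul_nonneg hx0.le (sq_nonneg L)) hT0
  linarith [mul_nonneg hCA0 h2, mul_nonneg hCB0 h2, mul_nonneg hCF0 h1]

/-! ## §6. The `R`-side of the explicit formula in mean square over `[0, T]` -/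

/-- `⟨c, z⟩_ℝ = c · Re z` for real `c`. [folklore] -/
private theorem inner_ofReal_left' (c : ℝ) (z : ℂ) : inner ℝ (c : ℂ) z = c * z.re := by
  simp [Complex.inner, mul_comm]

/-- For complex `a, g, r` and positive `q, s`:
`|‖−a+g+r‖² − ‖a‖² − ‖g‖² + 2⟨g,a⟩| ≤ (q‖a‖² + ‖r‖²/q) + (s‖g‖² + ‖r‖²/s) + ‖r‖²`. [folklore] -/
private theorem abs_norm_sq_three_sub_add_le' (a g r : ℂ) {q s : ℝ} (hq : 0 < q) (hs : 0 < s) :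
    |‖-a + g + r‖ ^ 2 - ‖a‖ ^ 2 - ‖g‖ ^ 2 + 2 * inner ℝ g a| ≤
      (q * ‖a‖ ^ 2 + ‖r‖ ^ 2 / q) + (s * ‖g‖ ^ 2 + ‖r‖ ^ 2 / s) + ‖r‖ ^ 2 := by
  have e1 : ‖-a + g + r‖ ^ 2 = ‖g - a‖ ^ 2 + 2 * inner ℝ (g - a) r + ‖r‖ ^ 2 := by
    rw [show -a + g = g - a by ring]; exact norm_add_sq_real _ _
  have e2 : ‖g - a‖ ^ 2 = ‖g‖ ^ 2 - 2 * inner ℝ g a + ‖a‖ ^ 2 := norm_sub_sq_real _ _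
  have e3 : inner ℝ (g - a) r = inner ℝ g r - inner ℝ a r := inner_sub_left _ _ _
  have b2 : |inner ℝ g r| ≤ ‖g‖ * ‖r‖ := abs_real_inner_le_norm _ _
  have b3 : |inner ℝ a r| ≤ ‖a‖ * ‖r‖ := abs_real_inner_le_norm _ _
  have c2 := two_mul_le_mul_sq_add_sq_div hq ‖a‖ ‖r‖
  have c3 := two_mul_le_mul_sq_add_sq_div hs ‖g‖ ‖r‖
  rw [abs_le] at b2 b3 ⊢
  constructor <;> nlinarith [norm_nonneg a, norm_nonneg g, norm_nonneg r]

/-- Integrated form of `abs_norm_sq_three_sub_add_le'` on `[a, b]`. [folklore] -/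
private theorem abs_integral_norm_sq_three_sub_add_le' {A G R : ℝ → ℂ} (hA : Continuous A)
    (hG : Continuous G) (hR : Continuous R) {a b : ℝ} (hab : a ≤ b) {q s : ℝ} (hq : 0 < q) (hs : 0 < s) :
    |(∫ t in a..b, ‖-A t + G t + R t‖ ^ 2) - (∫ t in a..b, ‖A t‖ ^ 2) -
        (∫ t in a..b, ‖G t‖ ^ 2) + 2 * ∫ t in a..b, inner ℝ (G t) (A t)| ≤
      (q * (∫ t in a..b, ‖A t‖ ^ 2) + (∫ t in a..b, ‖R t‖ ^ 2) / q) +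
        (s * (∫ t in a..b, ‖G t‖ ^ 2) + (∫ t in a..b, ‖R t‖ ^ 2) / s) +
        (∫ t in a..b, ‖R t‖ ^ 2) := by
  have iA : IntervalIntegrable (fun t ↦ ‖A t‖ ^ 2) volume a b :=
    (by fun_prop : Continuous fun t ↦ ‖A t‖ ^ 2).intervalIntegrable a b
  have iG : IntervalIntegrable (fun t ↦ ‖G t‖ ^ 2) volume a b :=
    (by fun_prop : Continuous fun t ↦ ‖G t‖ ^ 2).intervalIntegrable a b
  have iR : IntervalIntegrable (fun t ↦ ‖R t‖ ^ 2) volume a b :=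
    (by fun_prop : Continuous fun t ↦ ‖R t‖ ^ 2).intervalIntegrable a b
  have iΦ : IntervalIntegrable (fun t ↦ ‖-A t + G t + R t‖ ^ 2) volume a b :=
    (by fun_prop : Continuous fun t ↦ ‖-A t + G t + R t‖ ^ 2).intervalIntegrable a b
  have iX : IntervalIntegrable (fun t ↦ inner ℝ (G t) (A t)) volume a b :=
    (hG.inner hA).intervalIntegrable a b
  have hdiff : (∫ t in a..b, ‖-A t + G t + R t‖ ^ 2) - (∫ t in a..b, ‖A t‖ ^ 2) -
      (∫ t in a..b, ‖G t‖ ^ 2) + 2 * ∫ t in a..b, inner ℝ (G t) (A t) =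
        ∫ t in a..b, (‖-A t + G t + R t‖ ^ 2 - ‖A t‖ ^ 2 - ‖G t‖ ^ 2 + 2 * inner ℝ (G t) (A t)) := by
    rw [intervalIntegral.integral_add ((iΦ.sub iA).sub iG) (iX.const_mul 2),
      intervalIntegral.integral_sub (iΦ.sub iA) iG, intervalIntegral.integral_sub iΦ iA,
      intervalIntegral.integral_const_mul]
  set bound : ℝ → ℝ := fun t ↦
    (q * ‖A t‖ ^ 2 + ‖R t‖ ^ 2 / q) + (s * ‖G t‖ ^ 2 + ‖R t‖ ^ 2 / s) + ‖R t‖ ^ 2 with hbound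
  have ibound : IntervalIntegrable bound volume a b := by
    rw [hbound]
    exact (by fun_prop : Continuous fun t ↦ (q * ‖A t‖ ^ 2 + ‖R t‖ ^ 2 / q) +
      (s * ‖G t‖ ^ 2 + ‖R t‖ ^ 2 / s) + ‖R t‖ ^ 2).intervalIntegrable a b
  have hle : ‖∫ t in a..b, (‖-A t + G t + R t‖ ^ 2 - ‖A t‖ ^ 2 - ‖G t‖ ^ 2 +
      2 * inner ℝ (G t) (A t))‖ ≤ ∫ t in a..b, bound t :=
    intervalIntegral.norm_integral_le_of_norm_le hab (Eventually.of_forall fun t _ ↦ by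
      rw [Real.norm_eq_abs]; exact abs_norm_sq_three_sub_add_le' _ _ _ hq hs) ibound
  rw [hdiff, ← Real.norm_eq_abs]
  refine hle.trans (le_of_eq ?_)
  rw [hbound]
  simp only
  have iGs : IntervalIntegrable (fun t ↦ s * ‖G t‖ ^ 2) volume a b := iG.const_mul s
  have iRq : IntervalIntegrable (fun t ↦ ‖R t‖ ^ 2 / q) volume a b := iR.div_const q
  have iRs : IntervalIntegrable (fun t ↦ ‖R t‖ ^ 2 / s) volume a b := iR.div_const s
  have iAq : IntervalIntegrable (fun t ↦ q * ‖A t‖ ^ 2) volume a b := iA.const_mul q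
  rw [intervalIntegral.integral_add ((iAq.add iRq).add (iGs.add iRs)) iR,
    intervalIntegral.integral_add (iAq.add iRq) (iGs.add iRs), intervalIntegral.integral_add iAq iRq,
    intervalIntegral.integral_add iGs iRs, intervalIntegral.integral_const_mul,
    intervalIntegral.integral_const_mul, intervalIntegral.integral_div, intervalIntegral.integral_div]

/-- The bookkeeping of `rside_upTo`: pure real arithmetic (the same inequalities as for the dyadic
window, `UnconditionalPairCorrelationProofs.lean`). [folklore] -/
private theorem rside_bookkeeping' {T x sL IA IG IR IX Φ C₁ C₃ K₄ P : ℝ} (hT : 4 ≤ T) (hx : 1 ≤ x)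
    (hxT : x ≤ T) (hsL0 : 0 < sL) (hsL1 : 1 ≤ sL) (hsL2 : sL ^ 2 = Real.log T)
    (hlogT : Real.log T ≤ T) (hlog1 : 1 ≤ Real.log T) (hlx : 0 ≤ Real.log x)
    (hlxT : Real.log x ≤ Real.log T) (hK₄0 : 0 ≤ K₄)
    (hP : P = T * x + x ^ 2 + x * Real.sqrt (x * T * (Real.log x + 1)))
    (hIRb : IR ≤ 342 * x ^ 2 + 16 * C₁ ^ 2 * T / x)
    (hIAb : |IA - T * x * Real.log x| ≤ 3 * |C₃| * P)
    (hIGb : |IG - T / x * Real.log T ^ 2| ≤ 254 * (T / x) * Real.log T)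
    (hIXb : |IX| ≤ 2 * K₄ * x * Real.log (2 * T + 2))
    (h5 : ∀ q s : ℝ, 0 < q → 0 < s →
      |Φ - IA - IG + 2 * IX| ≤ (q * IA + IR / q) + (s * IG + IR / s) + IR) :
    |Φ - (T * x * Real.log x + T / x * Real.log T ^ 2)| ≤
      (2600 + 20 * |C₃| + 8 * K₄ + 80 * C₁ ^ 2) * (T * sL ^ 3 / x + x * T * sL) := by
  -- basic signs
  have hx0 : 0 < x := by linarith only [hx]
  have hT0 : 0 < T := by linarith only [hT]
  have hxT0 : 0 ≤ x * T := (mul_pos hx0 hT0).le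
  have hsL30 : 0 < sL ^ 3 := pow_pos hsL0 3
  have hE1 : 0 ≤ T * sL ^ 3 / x := div_nonneg (mul_nonneg hT0.le hsL30.le) hx0.le
  have hE2 : 0 ≤ x * T * sL := mul_nonneg hxT0 hsL0.le
  have hC3 : 0 ≤ |C₃| := abs_nonneg _
  have hC1 : 0 ≤ C₁ ^ 2 := sq_nonneg _
  have hlx2 : 0 < Real.log x + 2 := by linarith only [hlx]
  have hq : 0 < sL / (Real.log x + 2) := div_pos hsL0 hlx2
  have hs : 0 < x / sL ^ 3 := div_pos hx0 hsL30
  have h5 := h5 (sL / (Real.log x + 2)) (x / sL ^ 3) hq hs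
  set E : ℝ := T * sL ^ 3 / x + x * T * sL with hE
  have hE0 : 0 ≤ E := by rw [hE]; exact add_nonneg hE1 hE2
  have hlog2T : Real.log (2 * T + 2) ≤ 2 * sL ^ 2 := by
    rw [hsL2]
    have h' : 2 * T + 2 ≤ T ^ 2 := by
      have := mul_le_mul_of_nonneg_right hT (by linarith only [hT] : 0 ≤ T - 2)
      rw [sq]; linarith only [this, hT]
    calc Real.log (2 * T + 2) ≤ Real.log (T ^ 2) := Real.log_le_log (by linarith only [hT]) h'
      _ = 2 * Real.log T := by rw [Real.log_pow]; norm_num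
  -- elementary comparisons
  have hx2 : x ^ 2 ≤ x * T := by rw [sq]; exact mul_le_mul_of_nonneg_left hxT hx0.le
  have hsLT : sL ^ 2 ≤ T := by rw [hsL2]; exact hlogT
  have hsL3 : sL ^ 2 ≤ sL ^ 3 := pow_le_pow_right₀ hsL1 (by norm_num)
  have hsL13 : 1 ≤ sL ^ 3 := one_le_pow₀ hsL1
  have c1 : T * x ≤ x * T * sL := by
    rw [mul_comm T x]; exact le_mul_of_one_le_right hxT0 hsL1
  have c2 : x ^ 2 ≤ x * T * sL := hx2.trans (le_mul_of_one_le_right hxT0 hsL1)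
  have c3 : T / x ≤ T * sL ^ 3 / x :=
    div_le_div_of_nonneg_right (le_mul_of_one_le_right hT0.le hsL13) hx0.le
  have c4 : T / x * sL ^ 2 ≤ T * sL ^ 3 / x := by
    rw [div_mul_eq_mul_div]
    exact div_le_div_of_nonneg_right (mul_le_mul_of_nonneg_left hsL3 hT0.le) hx0.le
  have c5 : x * sL ^ 3 ≤ x * T * sL := by
    have : sL ^ 3 ≤ T * sL := by
      rw [pow_succ]; exact mul_le_mul_of_nonneg_right hsLT hsL0.le
    calc x * sL ^ 3 ≤ x * (T * sL) := mul_le_mul_of_nonneg_left this hx0.le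
      _ = x * T * sL := by ring
  have c6 : x ^ 2 * sL ≤ x * T * sL := mul_le_mul_of_nonneg_right hx2 hsL0.le
  have c7 : T * sL ≤ x * T * sL := by
    rw [mul_assoc]; exact le_mul_of_one_le_left (mul_nonneg hT0.le hsL0.le) hx
  have c8 : T * sL ^ 3 / x ^ 2 ≤ T * sL ^ 3 / x :=
    div_le_div_of_nonneg_left (mul_nonneg hT0.le hsL30.le) hx0 (le_self_pow₀ hx two_ne_zero)
  -- the square root in `P`
  have hsqrt0 : 0 ≤ Real.sqrt (x * T * (Real.log x + 1)) := Real.sqrt_nonneg _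
  have hsqrt : Real.sqrt (x * T * (Real.log x + 1)) ≤ 2 * T * sL := by
    have h1 : x * T * (Real.log x + 1) ≤ (2 * T * sL) ^ 2 := by
      rw [mul_pow, mul_pow, hsL2]
      have s1 : x * T * (Real.log x + 1) ≤ x * T * (2 * Real.log T) :=
        mul_le_mul_of_nonneg_left (by linarith only [hlxT, hlog1]) hxT0
      have s2 : x * T * (2 * Real.log T) ≤ T * T * (2 * Real.log T) :=
        mul_le_mul_of_nonneg_right (mul_le_mul_of_nonneg_right hxT hT0.le) (by linarith only [hlog1])
      have s3 : 0 ≤ T * T * (2 * Real.log T) :=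
        mul_nonneg (mul_nonneg hT0.le hT0.le) (by linarith only [hlog1])
      linarith only [s1, s2, s3]
    calc Real.sqrt (x * T * (Real.log x + 1)) ≤ Real.sqrt ((2 * T * sL) ^ 2) := Real.sqrt_le_sqrt h1
      _ = 2 * T * sL := Real.sqrt_sq (mul_nonneg (mul_nonneg (by norm_num) hT0.le) hsL0.le)
  have hsq2 : Real.sqrt (x * T * (Real.log x + 1)) ≤ T * (Real.log x + 1) := by
    have hl1 : 1 ≤ Real.log x + 1 := by linarith only [hlx]
    have h1 : x * T * (Real.log x + 1) ≤ (T * (Real.log x + 1)) ^ 2 := by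
      rw [mul_pow]
      have h' : Real.log x + 1 ≤ (Real.log x + 1) ^ 2 := le_self_pow₀ hl1 two_ne_zero
      have hxT2 : x * T ≤ T ^ 2 := by rw [sq]; exact mul_le_mul_of_nonneg_right hxT hT0.le
      calc x * T * (Real.log x + 1) ≤ T ^ 2 * (Real.log x + 1) :=
            mul_le_mul_of_nonneg_right hxT2 (by linarith only [hlx])
        _ ≤ T ^ 2 * (Real.log x + 1) ^ 2 := mul_le_mul_of_nonneg_left h' (sq_nonneg T)
    calc Real.sqrt (x * T * (Real.log x + 1)) ≤ Real.sqrt ((T * (Real.log x + 1)) ^ 2) :=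
          Real.sqrt_le_sqrt h1
      _ = T * (Real.log x + 1) := Real.sqrt_sq (mul_nonneg hT0.le (by linarith only [hlx]))
  have hP0 : 0 ≤ P := by
    rw [hP]; exact add_nonneg (add_nonneg (by linarith only [hxT0]) (sq_nonneg x)) (mul_nonneg hx0.le hsqrt0)
  have hPE : P ≤ 4 * E := by
    have h1 := mul_le_mul_of_nonneg_left hsqrt hx0.le
    have e : x * (2 * T * sL) = 2 * (x * T * sL) := by ring
    rw [hP, hE]
    linarith only [h1, e, c1, c2, hE1]
  have hPlog : P ≤ 2 * (T * x * (Real.log x + 2)) := by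
    have h1 := mul_le_mul_of_nonneg_left hsq2 hx0.le
    have h0 : 0 ≤ T * x * Real.log x := mul_nonneg (mul_nonneg hT0.le hx0.le) hlx
    have e : x * (T * (Real.log x + 1)) = T * x * Real.log x + T * x := by ring
    have e2 : 2 * (T * x * (Real.log x + 2)) = 2 * (T * x * Real.log x) + 4 * (T * x) := by ring
    have e3 : x * T = T * x := mul_comm x T
    rw [hP, e2]
    linarith only [h1, e, hx2, h0, e3, hxT0]
  -- (b1) `|IA − Tx log x| ≤ 12|C₃| E`
  have b1 : |IA - T * x * Real.log x| ≤ 12 * |C₃| * E := by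
    calc |IA - T * x * Real.log x| ≤ 3 * |C₃| * P := hIAb
      _ ≤ 3 * |C₃| * (4 * E) := mul_le_mul_of_nonneg_left hPE (by linarith only [hC3])
      _ = 12 * |C₃| * E := by ring
  -- (b2) `|IG − (T/x) log²T| ≤ 254 E`
  have b2 : |IG - T / x * Real.log T ^ 2| ≤ 254 * E := by
    refine hIGb.trans ?_
    rw [← hsL2, hE]
    linarith only [c4, hE2]
  -- (b3) `|IX| ≤ 4K₄ E`
  have b3 : |IX| ≤ 4 * K₄ * E := by
    have hK4x : 0 ≤ 2 * K₄ * x := mul_nonneg (by linarith only [hK₄0]) hx0.le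
    have h1 : |IX| ≤ 2 * K₄ * x * (2 * sL ^ 2) := hIXb.trans (mul_le_mul_of_nonneg_left hlog2T hK4x)
    have h2 : x * sL ^ 2 ≤ x * T * sL := by
      calc x * sL ^ 2 = x * sL * sL := by ring
        _ ≤ x * T * sL := mul_le_mul_of_nonneg_right
            (mul_le_mul_of_nonneg_left (by linarith only [hsLT, hsL1, sq_nonneg (sL - 1)]) hx0.le) hsL0.le
    have h3 : 2 * K₄ * x * (2 * sL ^ 2) = 4 * K₄ * (x * sL ^ 2) := by ring
    have h4 := mul_le_mul_of_nonneg_left h2 (by linarith only [hK₄0] : 0 ≤ 4 * K₄)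
    have h5' := mul_le_mul_of_nonneg_left (show x * T * sL ≤ E by rw [hE]; linarith only [hE1])
      (by linarith only [hK₄0] : 0 ≤ 4 * K₄)
    linarith only [h1, h3, h4, h5']
  -- (b4) `q IA ≤ (1 + 6|C₃|) E`
  have hIAle : IA ≤ (1 + 6 * |C₃|) * (T * x * (Real.log x + 2)) := by
    have h1 := (abs_le.1 hIAb).2
    have h2 : T * x * Real.log x ≤ T * x * (Real.log x + 2) :=
      mul_le_mul_of_nonneg_left (by linarith only [hlx]) (mul_nonneg hT0.le hx0.le)
    have h3 := mul_le_mul_of_nonneg_left hPlog (by linarith only [hC3] : 0 ≤ 3 * |C₃|)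
    have e : 3 * |C₃| * (2 * (T * x * (Real.log x + 2))) = 6 * |C₃| * (T * x * (Real.log x + 2)) := by ring
    have e2 : (1 + 6 * |C₃|) * (T * x * (Real.log x + 2)) =
        T * x * (Real.log x + 2) + 6 * |C₃| * (T * x * (Real.log x + 2)) := by ring
    linarith only [h1, h2, h3, e, e2]
  have b4 : sL / (Real.log x + 2) * IA ≤ (1 + 6 * |C₃|) * E := by
    have hc0 : 0 ≤ 1 + 6 * |C₃| := by linarith only [hC3]
    calc sL / (Real.log x + 2) * IA
        ≤ sL / (Real.log x + 2) * ((1 + 6 * |C₃|) * (T * x * (Real.log x + 2))) :=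
          mul_le_mul_of_nonneg_left hIAle hq.le
      _ = (1 + 6 * |C₃|) * (x * T * sL) := by field_simp
      _ ≤ (1 + 6 * |C₃|) * E := by
          refine mul_le_mul_of_nonneg_left ?_ hc0
          rw [hE]; linarith only [hE1]
  -- (b5) `IR/q ≤ (1026 + 48 C₁²) E`
  have hlx3 : Real.log x + 2 ≤ 3 * sL ^ 2 := by rw [hsL2]; linarith only [hlxT, hlog1]
  have hIRB0 : 0 ≤ 342 * x ^ 2 + 16 * C₁ ^ 2 * T / x :=
    add_nonneg (mul_nonneg (by norm_num) (sq_nonneg x))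
      (div_nonneg (mul_nonneg (mul_nonneg (by norm_num) hC1) hT0.le) hx0.le)
  have b5 : IR / (sL / (Real.log x + 2)) ≤ (1026 + 48 * C₁ ^ 2) * E := by
    rw [div_div_eq_mul_div, div_le_iff₀ hsL0]
    have h1 : IR * (Real.log x + 2) ≤ (342 * x ^ 2 + 16 * C₁ ^ 2 * T / x) * (3 * sL ^ 2) :=
      mul_le_mul hIRb hlx3 hlx2.le hIRB0
    refine h1.trans ?_
    have e1 : (342 * x ^ 2 + 16 * C₁ ^ 2 * T / x) * (3 * sL ^ 2) =
        (1026 * (x ^ 2 * sL) + 48 * C₁ ^ 2 * (T / x * sL)) * sL := by ring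
    rw [e1]
    refine mul_le_mul_of_nonneg_right ?_ hsL0.le
    have h2 : T / x * sL ≤ T * sL ^ 3 / x := by
      rw [div_mul_eq_mul_div]
      refine div_le_div_of_nonneg_right (mul_le_mul_of_nonneg_left ?_ hT0.le) hx0.le
      calc sL = sL * 1 * 1 := by ring
        _ ≤ sL * sL * sL := mul_le_mul (mul_le_mul_of_nonneg_left hsL1 hsL0.le) hsL1 zero_le_one
            (mul_nonneg hsL0.le hsL0.le)
        _ = sL ^ 3 := by ring
    have h3 := mul_le_mul_of_nonneg_left h2 (mul_nonneg (by norm_num) hC1 : 0 ≤ 48 * C₁ ^ 2)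
    have h4 : 0 ≤ 48 * C₁ ^ 2 * (x * T * sL) := mul_nonneg (mul_nonneg (by norm_num) hC1) hE2
    have h5' : 0 ≤ 1026 * (T * sL ^ 3 / x) := mul_nonneg (by norm_num) hE1
    rw [hE]
    linarith only [c6, h3, h4, h5']
  -- (b6) `s IG ≤ 255 E`
  have hIGle : IG ≤ 255 * (T / x) * sL ^ 4 := by
    have h1 := (abs_le.1 hIGb).2
    rw [← hsL2] at h1
    have hTx : 0 ≤ T / x := div_nonneg hT0.le hx0.le
    have h2 : T / x * sL ^ 2 ≤ T / x * sL ^ 4 :=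
      mul_le_mul_of_nonneg_left (pow_le_pow_right₀ hsL1 (by norm_num)) hTx
    have h3 : T / x * (sL ^ 2) ^ 2 = T / x * sL ^ 4 := by ring
    linarith only [h1, h2, h3]
  have b6 : x / sL ^ 3 * IG ≤ 255 * E := by
    calc x / sL ^ 3 * IG ≤ x / sL ^ 3 * (255 * (T / x) * sL ^ 4) :=
          mul_le_mul_of_nonneg_left hIGle hs.le
      _ = 255 * (T * sL) := by field_simp
      _ ≤ 255 * E := by rw [hE]; linarith only [c7, hE1]
  -- (b7) `IR/s ≤ (342 + 16 C₁²) E`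
  have b7 : IR / (x / sL ^ 3) ≤ (342 + 16 * C₁ ^ 2) * E := by
    rw [div_div_eq_mul_div, div_le_iff₀ hx0]
    calc IR * sL ^ 3 ≤ (342 * x ^ 2 + 16 * C₁ ^ 2 * T / x) * sL ^ 3 :=
          mul_le_mul_of_nonneg_right hIRb hsL30.le
      _ = (342 * (x * sL ^ 3) + 16 * C₁ ^ 2 * (T * sL ^ 3 / x ^ 2)) * x := by field_simp
      _ ≤ ((342 + 16 * C₁ ^ 2) * E) * x := by
          refine mul_le_mul_of_nonneg_right ?_ hx0.le
          have h3 := mul_le_mul_of_nonneg_left c8 (mul_nonneg (by norm_num) hC1 : 0 ≤ 16 * C₁ ^ 2)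
          have h4 : 0 ≤ 16 * C₁ ^ 2 * (x * T * sL) := mul_nonneg (mul_nonneg (by norm_num) hC1) hE2
          have h5' : 0 ≤ 342 * (T * sL ^ 3 / x) := mul_nonneg (by norm_num) hE1
          rw [hE]
          linarith only [c5, h3, h4, h5']
  -- (b8) `IR ≤ (342 + 16 C₁²) E`
  have b8 : IR ≤ (342 + 16 * C₁ ^ 2) * E := by
    refine hIRb.trans ?_
    have h3 : 16 * C₁ ^ 2 * T / x = 16 * C₁ ^ 2 * (T / x) := by ring
    have h4 := mul_le_mul_of_nonneg_left c3 (mul_nonneg (by norm_num) hC1 : 0 ≤ 16 * C₁ ^ 2)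
    have h5' : 0 ≤ 16 * C₁ ^ 2 * (x * T * sL) := mul_nonneg (mul_nonneg (by norm_num) hC1) hE2
    have h6 : 0 ≤ 342 * (T * sL ^ 3 / x) := mul_nonneg (by norm_num) hE1
    rw [hE, h3]
    linarith only [c2, h4, h5', h6]
  -- assemble
  have hB : sL / (Real.log x + 2) * IA + IR / (sL / (Real.log x + 2)) +
      (x / sL ^ 3 * IG + IR / (x / sL ^ 3)) + IR ≤ (1966 + 6 * |C₃| + 80 * C₁ ^ 2) * E := by
    linarith only [b4, b5, b6, b7, b8]
  have hC3E : 0 ≤ |C₃| * E := mul_nonneg hC3 hE0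
  have hC1E : 0 ≤ C₁ ^ 2 * E := mul_nonneg hC1 hE0
  have hKE : 0 ≤ K₄ * E := mul_nonneg hK₄0 hE0
  rw [abs_le] at h5 b1 b2 b3 ⊢
  constructor <;> linarith only [h5.1, h5.2, b1.1, b1.2, b2.1, b2.2, b3.1, b3.2, hB, hC3E, hC1E, hKE, hE0]

set_option maxHeartbeats 400000 in
/-- **The `R`-side of the explicit formula in mean square over `[0, T]`** (BGST 2024, proof of
Theorem 1: "`R(x,T) = x⁻²T log T(log T + O(1)) + T(log x + O(√log T))`", multiplied by `x`): there is `C`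
such that for `T ≥ 4` and `1 ≤ x ≤ T`,
`|∫_0^T |2x^{1/2−it}S_u(x,t)|² dt − (Tx log x + (T/x) log²T)| ≤ C (T log^{3/2}T/x + xT√log T)`.
Ingredients: Lemma 1 (`baluyotEtAl2024_lemma1`), (P3♯) (`Montgomery.exists_meanSquare_dirichletSum_sharp`),
`∫_0^T log²(t+2) = T log²T + O(T log T)` (`Montgomery.abs_integral_log_add_two_sq_sub_le`), the cross term
(`exists_norm_integral_log_mul_dirichletSum_le`), and the `L²` algebra with the weights
`q = √log T/(log x+2)`, `s = x/log^{3/2}T`. [cite: BaluyotEtAl2024, §2 (proof of Theorem 1: `R(x,T)`)] -/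
theorem rside_upTo : ∃ C : ℝ, 0 ≤ C ∧ ∀ T : ℝ, 4 ≤ T → ∀ x : ℝ, 1 ≤ x → x ≤ T →
    |(∫ t in (0 : ℝ)..T, ‖2 * (x : ℂ) ^ ((1 / 2 : ℂ) - t * I) * zeroKernelSeries x t‖ ^ 2) -
        (T * x * Real.log x + T / x * Real.log T ^ 2)| ≤
      C * (T * Real.sqrt (Real.log T) ^ 3 / x + x * T * Real.sqrt (Real.log T)) := by
  obtain ⟨C₁, hC₁⟩ := baluyotEtAl2024_lemma1
  obtain ⟨C₃, hC₃⟩ := exists_meanSquare_dirichletSum_sharp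
  obtain ⟨K₄, hK₄0, hK₄⟩ := exists_norm_integral_log_mul_dirichletSum_le
  refine ⟨2600 + 20 * |C₃| + 8 * K₄ + 80 * C₁ ^ 2, by positivity, fun T hT x hx hxT ↦ ?_⟩
  have hx0 : 0 < x := by linarith
  have hx0' : (x : ℂ) ≠ 0 := ofReal_ne_zero.2 hx0.ne'
  have hT0 : 0 < T := by linarith
  have hT2 : (2 : ℝ) ≤ T := by linarith
  have hT0' : (0 : ℝ) ≤ T := hT0.le
  have hlog : 0 < Real.log T := Real.log_pos (by linarith)
  have hlog1 : 1 ≤ Real.log T := by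
    rw [← Real.log_exp 1]
    exact Real.log_le_log (Real.exp_pos 1) (by linarith [Real.exp_one_lt_d9])
  have hlogT : Real.log T ≤ T := by linarith [Real.log_le_sub_one_of_pos hT0]
  have hlx : 0 ≤ Real.log x := Real.log_nonneg hx
  have hlxT : Real.log x ≤ Real.log T := Real.log_le_log hx0 hxT
  set sL : ℝ := Real.sqrt (Real.log T) with hsL
  have hsL0 : 0 < sL := Real.sqrt_pos.2 hlog
  have hsL2 : sL ^ 2 = Real.log T := Real.sq_sqrt hlog.le
  have hsL1 : 1 ≤ sL := by rw [hsL]; exact Real.one_le_sqrt.2 hlog1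
  clear_value sL
  -- the Lemma-1 constant is non-negative
  have hC₁0 : 0 ≤ C₁ := by
    obtain ⟨E₁, E₂, hE₁, -, -⟩ := hC₁ x hx 0
    exact (norm_nonneg _).trans hE₁
  -- the functions
  set A : ℝ → ℂ := montgomeryDirichletSum x with hA
  set L : ℝ → ℂ := fun t ↦ 2 * (x : ℂ) ^ ((1 / 2 : ℂ) - t * I) * zeroKernelSeries x t with hL
  set gR : ℝ → ℝ := fun t ↦ x ^ (-(1 / 2) : ℝ) * Real.log (|t| + 2) with hgR
  set G : ℝ → ℂ := fun t ↦ (gR t : ℂ) with hG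
  have hGeq : ∀ t : ℝ, G t = (x : ℂ) ^ (-(1 / 2 : ℂ)) * (Real.log (|t| + 2) : ℂ) := by
    intro t
    simp only [hG, hgR]
    rw [Complex.ofReal_mul, Complex.ofReal_cpow hx0.le]
    push_cast
    ring_nf
  set R : ℝ → ℂ := fun t ↦ L t + A t - G t with hR
  have hAc : Continuous A := continuous_montgomeryDirichletSum hx0
  have hLc : Continuous L :=
    (continuous_const.mul (Continuous.const_cpow (by fun_prop) (Or.inl hx0'))).mul
      (continuous_zeroKernelSeries hx)
  have hgRc : Continuous gR := by
    simp only [hgR]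
    exact continuous_const.mul (Continuous.log (by fun_prop) fun t ↦ by positivity)
  have hGc : Continuous G := Complex.continuous_ofReal.comp hgRc
  have hRc : Continuous R := (hLc.add hAc).sub hGc
  -- the pointwise bound on `R`
  set Cx : ℝ := C₁ * x ^ (-(1 / 2) : ℝ) with hCx
  have hx12le : x ^ (-(1 / 2) : ℝ) ≤ 1 := Real.rpow_le_one_of_one_le_of_nonpos hx (by norm_num)
  have hx12pos : 0 < x ^ (-(1 / 2) : ℝ) := Real.rpow_pos_of_pos hx0 _
  have hCx0 : 0 ≤ Cx := by rw [hCx]; positivity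
  have hRb : ∀ t : ℝ, ‖R t‖ ≤ 64 * x / (|t| + 2) ^ 2 + 2 * Cx := by
    intro t
    obtain ⟨E₁, E₂, hE₁, hE₂, heq⟩ := hC₁ x hx t
    have hRt : R t = 2 * (x : ℂ) ^ ((1 : ℂ) - t * I) / ((1 / 2 + t * I) * (3 / 2 - t * I)) +
        (x : ℂ) ^ (-(1 / 2 : ℂ)) * E₁ + E₂ := by
      simp only [hR, hL, hA, heq, hGeq t]; ring
    have hx12 : ‖(x : ℂ) ^ (-(1 / 2 : ℂ))‖ = x ^ (-(1 / 2) : ℝ) := by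
      rw [norm_cpow_eq_rpow_re_of_pos hx0]; congr 1; simp
    have hE₂' : ‖E₂‖ ≤ Cx := by
      have h1 : x ^ (-2 : ℝ) ≤ x ^ (-(1 / 2) : ℝ) := Real.rpow_le_rpow_of_exponent_le hx (by norm_num)
      have h2 : x ^ (-2 : ℝ) / (|t| + 2) ≤ x ^ (-(1 / 2) : ℝ) :=
        (div_le_self (Real.rpow_nonneg hx0.le _) (by linarith [abs_nonneg t])).trans h1
      rw [hCx]
      exact hE₂.trans (mul_le_mul_of_nonneg_left h2 hC₁0)
    have hmid : ‖(x : ℂ) ^ (-(1 / 2 : ℂ)) * E₁‖ ≤ Cx := by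
      rw [norm_mul, hx12, hCx, mul_comm]
      exact mul_le_mul_of_nonneg_right hE₁ hx12pos.le
    rw [hRt]
    calc ‖2 * (x : ℂ) ^ ((1 : ℂ) - t * I) / ((1 / 2 + t * I) * (3 / 2 - t * I)) +
          (x : ℂ) ^ (-(1 / 2 : ℂ)) * E₁ + E₂‖
        ≤ ‖2 * (x : ℂ) ^ ((1 : ℂ) - t * I) / ((1 / 2 + t * I) * (3 / 2 - t * I)) +
          (x : ℂ) ^ (-(1 / 2 : ℂ)) * E₁‖ + ‖E₂‖ := norm_add_le _ _
      _ ≤ (‖2 * (x : ℂ) ^ ((1 : ℂ) - t * I) / ((1 / 2 + t * I) * (3 / 2 - t * I))‖ +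
          ‖(x : ℂ) ^ (-(1 / 2 : ℂ)) * E₁‖) + ‖E₂‖ := by gcongr; exact norm_add_le _ _
      _ ≤ (64 * x / (|t| + 2) ^ 2 + Cx) + Cx := by gcongr; exact norm_mainTermB_le hx0 t
      _ = 64 * x / (|t| + 2) ^ 2 + 2 * Cx := by ring
  -- the integrals over `[0, T]`
  set IA : ℝ := ∫ t in (0 : ℝ)..T, ‖A t‖ ^ 2 with hIA
  set IG : ℝ := ∫ t in (0 : ℝ)..T, ‖G t‖ ^ 2 with hIG
  set IR : ℝ := ∫ t in (0 : ℝ)..T, ‖R t‖ ^ 2 with hIR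
  set IX : ℝ := ∫ t in (0 : ℝ)..T, inner ℝ (G t) (A t) with hIX
  have hIL : ∫ t in (0 : ℝ)..T, ‖-A t + G t + R t‖ ^ 2 =
      ∫ t in (0 : ℝ)..T, ‖2 * (x : ℂ) ^ ((1 / 2 : ℂ) - t * I) * zeroKernelSeries x t‖ ^ 2 := by
    refine intervalIntegral.integral_congr fun t _ ↦ ?_
    have : -A t + G t + R t = L t := by simp only [hR]; ring
    simp only [this, hL]
  -- `IR ≤ 342 x² + 8 C₁² T/x`
  have hIRb : IR ≤ 342 * x ^ 2 + 16 * C₁ ^ 2 * T / x := by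
    have h1 := integral_norm_sq_remainder_le hRc hx0 hRb (T := T) hT0'
    have hCx2 : Cx ^ 2 = C₁ ^ 2 * x⁻¹ := by
      rw [hCx, mul_pow, ← Real.rpow_natCast (x ^ (-(1 / 2) : ℝ)), ← Real.rpow_mul hx0.le,
        ← Real.rpow_neg_one]
      norm_num
    rw [hCx2] at h1
    have h0 : 0 ≤ 8 * C₁ ^ 2 * T / x := by positivity
    calc IR = ∫ t in (0 : ℝ)..T, ‖R t‖ ^ 2 := hIR
      _ ≤ 342 * x ^ 2 + 8 * (C₁ ^ 2 * x⁻¹) * T := h1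
      _ = 342 * x ^ 2 + 8 * C₁ ^ 2 * T / x := by rw [div_eq_mul_inv]; ring
      _ ≤ 342 * x ^ 2 + 16 * C₁ ^ 2 * T / x := by
          have e : 16 * C₁ ^ 2 * T / x = 2 * (8 * C₁ ^ 2 * T / x) := by ring
          rw [e]; linarith
  -- `IA`, (P3♯) once
  set P : ℝ := T * x + x ^ 2 + x * Real.sqrt (x * T * (Real.log x + 1)) with hP
  have hP0 : 0 ≤ P := by positivity
  have hIAb : |IA - T * x * Real.log x| ≤ 3 * |C₃| * P := by
    have h1 := hC₃ x hx T hT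
    have hle1 : C₃ * P ≤ |C₃| * P := mul_le_mul_of_nonneg_right (le_abs_self _) hP0
    have hle3 : |C₃| * P ≤ 3 * |C₃| * P := by nlinarith [abs_nonneg C₃]
    rw [hIA]
    exact h1.trans (hle1.trans hle3)
  -- `IG = x⁻¹ J(T)`
  have hIGb : |IG - T / x * Real.log T ^ 2| ≤ 254 * (T / x) * Real.log T := by
    have hfun : (fun t ↦ ‖G t‖ ^ 2) = fun t ↦ ‖(x : ℂ) ^ (-(1 / 2 : ℂ)) * (Real.log (|t| + 2) : ℂ)‖ ^ 2 :=
      funext fun t ↦ by rw [hGeq t]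
    have h1 : ∫ t in (0 : ℝ)..T, ‖G t‖ ^ 2 = x⁻¹ * ∫ t in (0 : ℝ)..T, Real.log (t + 2) ^ 2 := by
      rw [hfun]; exact integral_norm_sq_cpow_neg_half_mul_log hx0 hT0'
    have hJ := abs_integral_log_add_two_sq_sub_le hT2
    rw [hIG, h1, show T / x * Real.log T ^ 2 = x⁻¹ * (T * Real.log T ^ 2) by ring, ← mul_sub, abs_mul,
      abs_of_pos (inv_pos.2 hx0), show 254 * (T / x) * Real.log T = x⁻¹ * (254 * T * Real.log T) by ring]
    refine mul_le_mul_of_nonneg_left (hJ.trans ?_) (inv_pos.2 hx0).le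
    nlinarith [hlog.le, hT0.le]
  -- the cross term
  have hIXb : |IX| ≤ 2 * K₄ * x * Real.log (2 * T + 2) := by
    set CI : ℂ := ∫ t in (0 : ℝ)..T, (Real.log (t + 2) : ℂ) * A t with hCI
    have hint : IntervalIntegrable (fun t ↦ (Real.log (t + 2) : ℂ) * A t) volume 0 T := by
      refine ((Complex.continuous_ofReal.comp_continuousOn ?_).mul hAc.continuousOn).intervalIntegrable
      exact ContinuousOn.log (by fun_prop) fun t ht ↦ by
        rw [Set.uIcc_of_le hT0'] at ht; linarith [ht.1]
    have hIXeq : IX = x ^ (-(1 / 2) : ℝ) * CI.re := by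
      have h1 : IX = ∫ t in (0 : ℝ)..T, x ^ (-(1 / 2) : ℝ) * ((Real.log (t + 2) : ℂ) * A t).re := by
        rw [hIX]
        refine intervalIntegral.integral_congr fun t ht ↦ ?_
        rw [Set.uIcc_of_le hT0'] at ht
        have ht0 : 0 ≤ t := ht.1
        simp only [hG, hgR, inner_ofReal_left', Complex.re_ofReal_mul, abs_of_nonneg ht0]
        ring
      rw [h1, intervalIntegral.integral_const_mul]
      congr 1
      have := Complex.reCLM.intervalIntegral_comp_comm hint
      simpa using this
    have hCIb : ‖CI‖ ≤ 2 * K₄ * x * Real.log (2 * T + 2) := by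
      have h1 := hK₄ x hx T hT0'
      have hlogle : Real.log (T + 2) ≤ Real.log (2 * T + 2) := Real.log_le_log (by linarith) (by linarith)
      have hl0 : 0 ≤ Real.log (2 * T + 2) := Real.log_nonneg (by linarith)
      have := mul_le_mul_of_nonneg_left hlogle (by positivity : 0 ≤ K₄ * x)
      rw [hCI]
      nlinarith [h1, this, mul_nonneg (mul_nonneg hK₄0 hx0.le) hl0]
    rw [hIXeq, abs_mul, abs_of_pos hx12pos]
    calc x ^ (-(1 / 2) : ℝ) * |CI.re| ≤ 1 * ‖CI‖ :=
          mul_le_mul hx12le (Complex.abs_re_le_norm CI) (abs_nonneg _) zero_le_one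
      _ ≤ 2 * K₄ * x * Real.log (2 * T + 2) := by rw [one_mul]; exact hCIb
  -- the `L²` algebra with `q = sL/(log x + 2)`, `s = x/sL³`, and the bookkeeping
  have h5 : ∀ q s : ℝ, 0 < q → 0 < s →
      |(∫ t in (0 : ℝ)..T, ‖2 * (x : ℂ) ^ ((1 / 2 : ℂ) - t * I) * zeroKernelSeries x t‖ ^ 2) -
          IA - IG + 2 * IX| ≤ (q * IA + IR / q) + (s * IG + IR / s) + IR := by
    intro q s hq hs
    have h := abs_integral_norm_sq_three_sub_add_le' hAc hGc hRc hT0' hq hs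
    rw [hIL] at h
    exact h
  exact rside_bookkeeping' hT hx hxT hsL0 hsL1 hsL2 hlogT hlog1 hlx hlxT hK₄0 hP hIRb hIAb hIGb hIXb h5

/-! ## §7. Assembly: (MT) for the window `0 < γ ≤ T` -/

/-- Bookkeeping: for all large `T`, `√T log³(T+2) ≤ T √log T`, `log²(T+2) ≤ T √log T` and
`T^{θ(T)−1} log³(T+2) ≤ √log T` follow from the same with `log(2T+2)`. [folklore] -/
private theorem eventually_log_upTo_le :
    ∀ᶠ T : ℝ in atTop, Real.sqrt T * Real.log (T + 2) ^ 3 ≤ T * Real.sqrt (Real.log T) ∧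
      Real.log (T + 2) ^ 2 ≤ T * Real.sqrt (Real.log T) := by
  have h6 := (Real.isLittleO_pow_log_id_atTop (n := 6)).def (by norm_num : (0 : ℝ) < 1 / 4096)
  have h2 := (Real.isLittleO_pow_log_id_atTop (n := 2)).def (by norm_num : (0 : ℝ) < 1 / 4)
  filter_upwards [h6, h2, eventually_ge_atTop 4] with T h6 h2 hT
  have hT0 : 0 < T := by linarith
  have hT1 : 1 < T := by linarith
  have hlog1 : 1 ≤ Real.log T := by
    rw [← Real.log_exp 1]
    exact Real.log_le_log (Real.exp_pos 1) (by linarith [Real.exp_one_lt_d9])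
  have hlog0 : 0 ≤ Real.log T := by linarith
  rw [id, Real.norm_of_nonneg (pow_nonneg hlog0 _), Real.norm_of_nonneg hT0.le] at h6 h2
  have hL : Real.log (T + 2) ≤ 2 * Real.log T := by
    have h' : T + 2 ≤ T ^ 2 := by nlinarith
    calc Real.log (T + 2) ≤ Real.log (T ^ 2) := Real.log_le_log (by linarith) h'
      _ = 2 * Real.log T := by rw [Real.log_pow]; norm_num
  have hL0 : 0 ≤ Real.log (T + 2) := Real.log_nonneg (by linarith)
  have hsL1 : 1 ≤ Real.sqrt (Real.log T) := Real.one_le_sqrt.2 hlog1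
  constructor
  · have h3 : Real.log (T + 2) ^ 3 ≤ 8 * Real.log T ^ 3 := by
      have := pow_le_pow_left₀ hL0 hL 3; nlinarith
    have h4 : 8 * Real.log T ^ 3 ≤ Real.sqrt T := by
      have h5 : (8 * Real.log T ^ 3) ^ 2 ≤ T := by nlinarith
      calc 8 * Real.log T ^ 3 = Real.sqrt ((8 * Real.log T ^ 3) ^ 2) := (Real.sqrt_sq (by positivity)).symm
        _ ≤ Real.sqrt T := Real.sqrt_le_sqrt h5
    have hsT : Real.sqrt T * Real.sqrt T = T := Real.mul_self_sqrt hT0.le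
    calc Real.sqrt T * Real.log (T + 2) ^ 3 ≤ Real.sqrt T * Real.sqrt T :=
          mul_le_mul_of_nonneg_left (h3.trans h4) (Real.sqrt_nonneg T)
      _ = T * 1 := by rw [hsT, mul_one]
      _ ≤ T * Real.sqrt (Real.log T) := mul_le_mul_of_nonneg_left hsL1 hT0.le
  · have h3 : Real.log (T + 2) ^ 2 ≤ 4 * Real.log T ^ 2 := by
      have := pow_le_pow_left₀ hL0 hL 2; nlinarith
    calc Real.log (T + 2) ^ 2 ≤ T * 1 := by linarith
      _ ≤ T * Real.sqrt (Real.log T) := mul_le_mul_of_nonneg_left hsL1 hT0.le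

/-- The bookkeeping of the assembly: pure real arithmetic (verbatim the dyadic one, with
`L = log(T+2)`). [folklore] -/
private theorem final_bookkeeping' {T x sL θ L J F Φ CZ CR : ℝ} (hT : 4 ≤ T) (hx : 1 ≤ x)
    (hxT : x ≤ T) (hsL0 : 0 < sL) (hsL2 : sL ^ 2 = Real.log T) (hθ1 : θ ≤ 1)
    (hL0 : 0 ≤ L) (hCZ : 0 ≤ CZ) (hCR : 0 ≤ CR)
    (hZ : |J - π / 2 * F| ≤ CZ * (x ^ (2 * θ - 1) * L ^ 3 + x * L ^ 2 / T))
    (hΦ : Φ = 4 * x * J)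
    (hR : |Φ - (T * x * Real.log x + T / x * Real.log T ^ 2)| ≤ CR * (T * sL ^ 3 / x + x * T * sL))
    (hθev : T ^ (θ - 1) * L ^ 3 ≤ sL) (hE4 : Real.sqrt T * L ^ 3 ≤ T * sL) (hE5 : L ^ 2 ≤ T * sL) :
    |F - (T / (2 * π * x ^ 2) * Real.log T ^ 2 + T / (2 * π) * Real.log x)| ≤
      (CR + 2 * CZ + 1) * (T / (2 * π * x ^ 2) * Real.log T ^ 2 / sL + T * sL) := by
  have hx0 : 0 < x := by linarith only [hx]
  have hT0 : 0 < T := by linarith only [hT]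
  have hπ3 : 3 < π := Real.pi_gt_three
  have hπ0 : 0 < π := Real.pi_pos
  have hxT0 : 0 ≤ x * T := (mul_pos hx0 hT0).le
  have hTsL : 0 ≤ T * sL := mul_nonneg hT0.le hsL0.le
  -- the factor `x^{2θ−1} L³ ≤ T sL`
  have hxpow : x ^ (2 * θ - 1) * L ^ 3 ≤ T * sL := by
    have hL3 : 0 ≤ L ^ 3 := pow_nonneg hL0 3
    rcases le_total x (Real.sqrt T) with hle | hge
    · have h1 : x ^ (2 * θ - 1) ≤ x := by
        calc x ^ (2 * θ - 1) ≤ x ^ (1 : ℝ) :=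
              Real.rpow_le_rpow_of_exponent_le hx (by linarith only [hθ1])
          _ = x := Real.rpow_one x
      calc x ^ (2 * θ - 1) * L ^ 3 ≤ Real.sqrt T * L ^ 3 :=
            mul_le_mul_of_nonneg_right (h1.trans hle) hL3
        _ ≤ T * sL := hE4
    · have hsT0 : 0 < Real.sqrt T := Real.sqrt_pos.2 hT0
      have h1 : x ^ (2 * θ - 1) = x * x ^ (2 * (θ - 1)) := by
        rw [show 2 * θ - 1 = 1 + 2 * (θ - 1) by ring, Real.rpow_add hx0, Real.rpow_one]
      have h2 : x ^ (2 * (θ - 1)) ≤ Real.sqrt T ^ (2 * (θ - 1)) :=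
        Real.rpow_le_rpow_of_nonpos hsT0 hge (by linarith only [hθ1])
      have h3 : Real.sqrt T ^ (2 * (θ - 1)) = T ^ (θ - 1) := by
        rw [Real.sqrt_eq_rpow, ← Real.rpow_mul hT0.le]
        congr 1; ring
      rw [h3] at h2
      have h4 : x ^ (2 * θ - 1) * L ^ 3 ≤ x * (T ^ (θ - 1) * L ^ 3) := by
        rw [h1, mul_assoc]
        exact mul_le_mul_of_nonneg_left (mul_le_mul_of_nonneg_right h2 hL3) hx0.le
      calc x ^ (2 * θ - 1) * L ^ 3 ≤ x * (T ^ (θ - 1) * L ^ 3) := h4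
        _ ≤ x * sL := mul_le_mul_of_nonneg_left hθev hx0.le
        _ ≤ T * sL := mul_le_mul_of_nonneg_right hxT hsL0.le
  have hxL : x * L ^ 2 / T ≤ T * sL := by
    have h1 : x * L ^ 2 / T ≤ L ^ 2 := by
      rw [div_le_iff₀ hT0]
      calc x * L ^ 2 ≤ T * L ^ 2 := mul_le_mul_of_nonneg_right hxT (sq_nonneg L)
        _ = L ^ 2 * T := mul_comm _ _
    exact h1.trans hE5
  have hZ2 : |J - π / 2 * F| ≤ 2 * CZ * (T * sL) := by
    refine hZ.trans ?_
    have := add_le_add hxpow hxL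
    calc CZ * (x ^ (2 * θ - 1) * L ^ 3 + x * L ^ 2 / T) ≤ CZ * (T * sL + T * sL) :=
          mul_le_mul_of_nonneg_left this hCZ
      _ = 2 * CZ * (T * sL) := by ring
  have hkey : |2 * π * x * F - (T * x * Real.log x + T / x * Real.log T ^ 2)| ≤
      8 * CZ * (x * T * sL) + CR * (T * sL ^ 3 / x + x * T * sL) := by
    have e : 2 * π * x * F - (T * x * Real.log x + T / x * Real.log T ^ 2) =
        (Φ - (T * x * Real.log x + T / x * Real.log T ^ 2)) - 4 * x * (J - π / 2 * F) := by
      rw [hΦ]; ring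
    rw [e]
    refine (abs_sub _ _).trans ?_
    rw [abs_mul, abs_of_pos (by linarith only [hx0] : (0 : ℝ) < 4 * x)]
    have h1 := mul_le_mul_of_nonneg_left hZ2 (by linarith only [hx0] : (0 : ℝ) ≤ 4 * x)
    have e2 : 4 * x * (2 * CZ * (T * sL)) = 8 * CZ * (x * T * sL) := by ring
    linarith only [hR, h1, e2]
  have h2πx : 0 < 2 * π * x := by positivity
  have e1 : F - (T / (2 * π * x ^ 2) * Real.log T ^ 2 + T / (2 * π) * Real.log x) =
      (2 * π * x * F - (T * x * Real.log x + T / x * Real.log T ^ 2)) / (2 * π * x) := by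
    field_simp
    ring
  rw [e1, abs_div, abs_of_pos h2πx, div_le_iff₀ h2πx]
  refine hkey.trans ?_
  have hsL3 : sL ^ 3 = Real.log T ^ 2 / sL := by
    rw [← hsL2]; field_simp
  have eA : T / (2 * π * x ^ 2) * Real.log T ^ 2 / sL * (2 * π * x) = T * sL ^ 3 / x := by
    rw [hsL3]; field_simp
  have hE1 : 0 ≤ T * sL ^ 3 / x := div_nonneg (mul_nonneg hT0.le (pow_nonneg hsL0.le 3)) hx0.le
  have hE2 : 0 ≤ x * T * sL := mul_nonneg hxT0 hsL0.le
  have eR : (CR + 2 * CZ + 1) * (T / (2 * π * x ^ 2) * Real.log T ^ 2 / sL + T * sL) * (2 * π * x) =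
      (CR + 2 * CZ + 1) * (T * sL ^ 3 / x) + (CR + 2 * CZ + 1) * (2 * π) * (x * T * sL) := by
    rw [mul_add, add_mul, mul_assoc (CR + 2 * CZ + 1) (T / (2 * π * x ^ 2) * Real.log T ^ 2 / sL), eA]
    ring
  rw [eR]
  have h1 : CR * (T * sL ^ 3 / x) ≤ (CR + 2 * CZ + 1) * (T * sL ^ 3 / x) :=
    mul_le_mul_of_nonneg_right (by linarith only [hCZ]) hE1
  have h2 : 8 * CZ * (x * T * sL) + CR * (x * T * sL) ≤ (CR + 2 * CZ + 1) * (2 * π) * (x * T * sL) := by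
    have : 8 * CZ + CR ≤ (CR + 2 * CZ + 1) * (2 * π) := by nlinarith only [hπ3, hCZ, hCR]
    have := mul_le_mul_of_nonneg_right this hE2
    linarith only [this]
  linarith only [h1, h2]

/-- `‖z − m‖ = |Re z − m|` for real `z` (`Im z = 0`) and real `m`. [folklore] -/
private theorem norm_sub_ofReal_eq' {z : ℂ} (hz : z.im = 0) (m : ℝ) : ‖z - (m : ℂ)‖ = |z.re - m| := by
  have : z = (z.re : ℂ) := Complex.ext (by simp) (by simp [hz])
  rw [this, ← Complex.ofReal_sub, Complex.norm_real, Real.norm_eq_abs, Complex.ofReal_re]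

/-- **The unconditional Montgomery theorem (MT) over the ORIGINAL window `0 < γ, γ′ ≤ T`** — BGST 2024
Theorem 1 with the error terms of the authors' 2025 correction: there are `C, T₀` such that for all
`T ≥ T₀` and `1 ≤ x ≤ T`,
`‖F(x,T) − ((T/(2πx²)) log²T + (T/2π) log x)‖ ≤ C ((T/(2πx²)) log²T/√log T + T√log T)`,
where `F(x,T) = Σ_{ρ,ρ′: 0<γ,γ′≤T} x^{ρ−ρ′} w(ρ−ρ′)` (`BGSTB2024.pairSum`, zeros with multiplicity).
(`F` is real, non-negative and `F(1/x,T) = F(x,T)` for every `x > 0`, `T`: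
`pairSum_im`, `pairSum_re_nonneg`, `pairSum_inv`, Lemma 3.) Proof: `2πx·Re F = 4x∫_0^T|S_u|² +
O(x·(x^{2θ−1}log³T + x log²T/T))` (`upTo_zeroSide`) `= ∫_0^T|2x^{1/2−it}S_u|² + … = Tx log x + (T/x)log²T +
O(T log^{3/2}T/x + xT√log T)` (`rside_upTo`), `θ = θ(T)` from the Vinogradov–Korobov region
(`exists_vkTheta`). The printed 2024 statement had the sharper (retracted) error terms; this is the form
the authors print in arXiv:2501.14545 §2 (there for the dyadic window; the 2024 window "could also be
done by modifying each step", which is what is done here).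
[cite: BaluyotEtAl2024, Theorem 1; BaluyotEtAl2025, §2 (MT)] -/
theorem pairSum_montgomeryTheorem :
    ∃ C : ℝ, ∃ T₀ : ℝ, ∀ T : ℝ, T₀ ≤ T → ∀ x : ℝ, 1 ≤ x → x ≤ T →
      ‖pairSum x T -
          ((T / (2 * Real.pi * x ^ 2) * Real.log T ^ 2 + T / (2 * Real.pi) * Real.log x : ℝ) : ℂ)‖ ≤
        C * (T / (2 * Real.pi * x ^ 2) * Real.log T ^ 2 / Real.sqrt (Real.log T) +
          T * Real.sqrt (Real.log T)) := by
  obtain ⟨CZ, hCZpos, hZ⟩ := upTo_zeroSide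
  obtain ⟨CR, hCR0, hR⟩ := rside_upTo
  obtain ⟨θ, hθ, hθev⟩ := exists_vkTheta
  obtain ⟨T₀, hT₀⟩ := Filter.eventually_atTop.1
    ((hθev.and eventually_log_upTo_le).and (eventually_ge_atTop (5 : ℝ)))
  refine ⟨CR + 2 * CZ + 1, T₀, fun T hT x hx hxT ↦ ?_⟩
  obtain ⟨⟨hθT, hE4, hE5⟩, hT5⟩ := hT₀ T hT
  have hT4 : (4 : ℝ) ≤ T := by linarith
  have hT0 : 0 < T := by linarith
  have hx0 : 0 < x := by linarith
  obtain ⟨hθ1, -, hθzeros⟩ := hθ T hT5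
  have hlog : 0 < Real.log T := Real.log_pos (by linarith)
  set sL : ℝ := Real.sqrt (Real.log T) with hsL
  have hsL0 : 0 < sL := Real.sqrt_pos.2 hlog
  have hsL2 : sL ^ 2 = Real.log T := Real.sq_sqrt hlog.le
  -- `log(T+2) ≤ log(2T+2)` in the Vinogradov–Korobov bookkeeping
  have hLle : Real.log (T + 2) ≤ Real.log (2 * T + 2) := Real.log_le_log (by linarith) (by linarith)
  have hL0 : 0 ≤ Real.log (T + 2) := Real.log_nonneg (by linarith)
  have hθT' : T ^ (θ T - 1) * Real.log (T + 2) ^ 3 ≤ sL := by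
    refine le_trans ?_ hθT
    exact mul_le_mul_of_nonneg_left (pow_le_pow_left₀ hL0 hLle 3) (Real.rpow_nonneg hT0.le _)
  -- the three analytic inputs
  have hZ' := hZ T hT4 x hx (θ T) hθ1 hθzeros
  have hR' := hR T hT4 x hx hxT
  have hΦ : (∫ t in (0 : ℝ)..T, ‖2 * (x : ℂ) ^ ((1 / 2 : ℂ) - t * I) * zeroKernelSeries x t‖ ^ 2) =
      4 * x * ∫ t in (0 : ℝ)..T, ‖zeroKernelSeries x t‖ ^ 2 := by
    rw [← intervalIntegral.integral_const_mul]
    refine intervalIntegral.integral_congr fun t _ ↦ ?_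
    simp only [norm_sq_two_mul_cpow_mul hx0]
  -- `F` is real
  have hreal := pairSum_im hx0 T
  rw [norm_sub_ofReal_eq' hreal]
  have key := final_bookkeeping' hT4 hx hxT hsL0 hsL2 hθ1 hL0 hCZpos.le hCR0 hZ' hΦ hR' hθT' hE4 hE5
  have e : T / (2 * π * x ^ 2) * Real.log T ^ 2 / sL =
      T / (2 * π * x ^ 2) * Real.log T ^ 2 / Real.sqrt (Real.log T) := by rw [hsL]
  rw [e] at key
  exact key

/-- **BGST 2024, Theorem 1, normalised form, with the corrected error terms**: there are `C, T₀` such that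
for `T ≥ T₀` and `0 ≤ α ≤ 1`, `‖F(α) − (T^{−2α} log T + α)‖ ≤ C (T^{−2α} √log T + 1/√log T)`, where
`F(α) = ((T/2π) log T)⁻¹ F(T^α, T)` (`BGSTB2024.formFactor`). This is `pairSum_montgomeryTheorem` at
`x = T^α`, divided by `(T/2π) log T`; the qualitative clauses (real, even, non-negative) are
`baluyotEtAl2024_theorem1_qualitative`. (The `@[deprecated]` fact `baluyotEtAl2024_theorem1` renders the
RETRACTED precision `O(T^{−2α} + 1/√log T)` and is NOT implied.)
[cite: BaluyotEtAl2024, Theorem 1 (1.4); BaluyotEtAl2025, §2 (MT)] -/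
theorem formFactor_montgomeryTheorem :
    ∃ C : ℝ, ∃ T₀ : ℝ, ∀ T : ℝ, T₀ ≤ T → ∀ α : ℝ, 0 ≤ α → α ≤ 1 →
      ‖formFactor α T - ((T ^ (-(2 * α)) * Real.log T + α : ℝ) : ℂ)‖ ≤
        C * (T ^ (-(2 * α)) * Real.sqrt (Real.log T) + 1 / Real.sqrt (Real.log T)) := by
  obtain ⟨C, T₀, h⟩ := pairSum_montgomeryTheorem
  refine ⟨2 * Real.pi * |C|, max T₀ 3, fun T hT α hα0 hα1 ↦ ?_⟩
  have hT₀ : T₀ ≤ T := le_trans (le_max_left _ _) hT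
  have hT3 : (3 : ℝ) ≤ T := le_trans (le_max_right _ _) hT
  have hT0 : 0 < T := by linarith
  have hT1 : 1 ≤ T := by linarith
  have hlog : 0 < Real.log T := Real.log_pos (by linarith)
  have hπ0 : 0 < Real.pi := Real.pi_pos
  set x : ℝ := T ^ α with hx
  have hx1 : 1 ≤ x := by rw [hx]; exact Real.one_le_rpow hT1 hα0
  have hxT : x ≤ T := by
    rw [hx]
    calc T ^ α ≤ T ^ (1 : ℝ) := Real.rpow_le_rpow_of_exponent_le hT1 hα1
      _ = T := Real.rpow_one T
  have hx0 : 0 < x := by linarith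
  have hmain := h T hT₀ x hx1 hxT
  -- the normalising factor `N = (T/2π) log T > 0`
  set N : ℝ := T / (2 * Real.pi) * Real.log T with hN
  have hN0 : 0 < N := by rw [hN]; positivity
  have hNC : ((T / (2 * Real.pi) * Real.log T : ℝ) : ℂ) = (N : ℂ) := by rw [hN]
  have hF : formFactor α T = (N : ℂ)⁻¹ * pairSum x T := by
    rw [formFactor, hNC, hx]
  -- `x² = T^{2α}`, `log x = α log T`
  have hx2 : x ^ 2 = T ^ (2 * α) := by
    rw [hx, ← Real.rpow_natCast, ← Real.rpow_mul hT0.le]; congr 1; push_cast; ring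
  have hx2inv : T ^ (-(2 * α)) = (x ^ 2)⁻¹ := by
    rw [hx2, Real.rpow_neg hT0.le]
  have hlogx : Real.log x = α * Real.log T := by rw [hx, Real.log_rpow hT0]
  -- the main term and the error divided by `N`
  have hsq : Real.sqrt (Real.log T) ^ 2 = Real.log T := Real.sq_sqrt hlog.le
  have hsL0 : 0 < Real.sqrt (Real.log T) := Real.sqrt_pos.2 hlog
  set sL : ℝ := Real.sqrt (Real.log T) with hsL
  have hsLne : sL ≠ 0 := hsL0.ne'
  have hxne : x ≠ 0 := hx0.ne'
  have hTne : T ≠ 0 := hT0.ne'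
  have hπne : Real.pi ≠ 0 := hπ0.ne'
  have e1 : ((T ^ (-(2 * α)) * Real.log T + α : ℝ) : ℂ) =
      (N : ℂ)⁻¹ * ((T / (2 * Real.pi * x ^ 2) * Real.log T ^ 2 + T / (2 * Real.pi) * Real.log x : ℝ) : ℂ) := by
    rw [← Complex.ofReal_inv, ← Complex.ofReal_mul]
    congr 1
    rw [hx2inv, hlogx, hN]
    field_simp
  set E : ℝ := T / (2 * Real.pi * x ^ 2) * Real.log T ^ 2 / sL + T * sL with hE
  have hE0 : 0 ≤ E := by rw [hE]; positivity
  have e2 : N⁻¹ * E = sL / x ^ 2 + 2 * Real.pi / sL := by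
    rw [hE, hN, ← hsq]
    field_simp
  have hfin : sL / x ^ 2 + 2 * Real.pi / sL ≤ 2 * Real.pi * ((x ^ 2)⁻¹ * sL + 1 / sL) := by
    have h2π : (1 : ℝ) ≤ 2 * Real.pi := by linarith [Real.pi_gt_three]
    have ha : 0 ≤ (x ^ 2)⁻¹ * sL := by positivity
    have h1 : sL / x ^ 2 ≤ 2 * Real.pi * ((x ^ 2)⁻¹ * sL) := by
      rw [div_eq_mul_inv, mul_comm sL]
      exact le_mul_of_one_le_left ha h2π
    have h2 : 2 * Real.pi / sL = 2 * Real.pi * (1 / sL) := by ring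
    rw [mul_add]
    linarith
  rw [hF, e1, ← mul_sub, norm_mul, norm_inv, Complex.norm_real, Real.norm_of_nonneg hN0.le, hx2inv]
  calc N⁻¹ * ‖pairSum x T -
        ((T / (2 * Real.pi * x ^ 2) * Real.log T ^ 2 + T / (2 * Real.pi) * Real.log x : ℝ) : ℂ)‖
      ≤ N⁻¹ * (C * E) := mul_le_mul_of_nonneg_left hmain (inv_pos.2 hN0).le
    _ ≤ N⁻¹ * (|C| * E) :=
        mul_le_mul_of_nonneg_left (mul_le_mul_of_nonneg_right (le_abs_self C) hE0) (inv_pos.2 hN0).le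
    _ = |C| * (N⁻¹ * E) := by ring
    _ = |C| * (sL / x ^ 2 + 2 * Real.pi / sL) := by rw [e2]
    _ ≤ |C| * (2 * Real.pi * ((x ^ 2)⁻¹ * sL + 1 / sL)) := mul_le_mul_of_nonneg_left hfin (abs_nonneg C)
    _ = 2 * Real.pi * |C| * ((x ^ 2)⁻¹ * sL + 1 / sL) := by ring

end BGSTB2024

end Literature.NumberTheory.LFunctions

end
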